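import Mathlib
import Literature.MathematicalPhysics.QuantumFieldTheory.Balaban1983to89.T4InputCauchyRateTermwise

/-!
# T4InputCauchyRateSecant — the SECANT FACE of the history-species output wall: the terms of the expansion, which see the previous
# potentials only through the exponential of a LINEAR functional, are compared at the two runs' history points DIRECTLY — `‖e^w −
# e^z‖ ≤ ‖w − z‖·(‖e^z‖ + ‖e^w‖)` under the integral sign, summed over the expansion — with NO reach, NO slack box, NO room and NO
# dilation in the history species, and with the FIRST-MOMENT budget `Σᵢ Nᵢaᵢ` (exponent bound in margin units × ABSOLUTE termwise
# majorant) in place of the sup-norm class constant `G` of every Cauchy-faced closure of the lineage; the scale recursion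
# re-proved with a reach-free history leg; closures; and a toy that DECIDES between the two faces (a history-blind bulk: every
# Cauchy-faced producer of the lineage is void on it, the secant closure fires) (cell `pub-balaban`, T⁴-continuum fan-out, node U3
# / spine estimate NE5, prover seat P1 = "cluster-expansion derivative bound: differentiate B13's convergent expansion in V and
# bound term-wise (analyticity strip ⇒ Cauchy estimate)"; a SIBLING LEAF of `T4InputCauchyRateTermwise` (file v1.2, frozen), which
# it imports BY NAME and does not modify; seat P2's `T4ActivityTilt` is CITED BY NAME for the term-level device and is NOT
# imported)

HONEST FRAMING. The cell's T4 target is rung (B)+1 (existence AND uniqueness of the ε → 0 limit of Bałaban's unit-scale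
expectations on a FIXED finite torus T⁴); NOT infinite volume, NOT a mass gap, NOT the Clay problem. The conditionals of the spine
(BetaPertH, (B), (B^μ)) are untouched by this module and stay explicit wherever the spine composes (`T4OutputRate` docstring;
T4-DAG §2). NOTHING printed in the audited papers is asserted here: `HistSecant`, `TermHistLip`, `TermHistExpLinearN`,
`ExpLinearAbsBound`, `HistPairInClass`, `HistBudgetA` below are HYPOTHESIS SHAPES over the hypothesis-carrying data
`T4InputCauchyRateData.StepModel`, an input class `K` and a term family `T` as in `T4InputCauchyRateTermwise`, on the ABSTRACT
carriers of `T4OutputRate` (to be ASSUMED by consumers, never cited as facts); every `theorem` is kernel-checked analysis (the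
mean value inequality `norm_image_sub_le_of_norm_deriv_le_segment_01'`, Bochner-integral bookkeeping), real bookkeeping about the
shapes of the imported leaves, and a toy. The estimate NE5 itself is NOT PRINTED anywhere in [Balaban1987RG1],
[Balaban1988RG2Cluster], [Balaban1988Convergent] (cell GAPS G-t4-U3-1); this module does not change that, derives no expansion,
majorant, exponent bound or modulus of any actual step map, and changes NO census value of `T4InputCauchyRateSpecies` NUMBERS
(f)–(g″): it books an ALTERNATIVE closure with its own currency (NUMBERS (h) below), to stand beside the dilation currency of
(g″), not to replace it.

WHERE IT SITS. After `T4InputCauchyRateTermwise` v1.2 the history-species half of the seat's output wall (W2-hist of the cell wall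
sheet `WALLS-NE5-P1.md`) is produced by ONE mechanism in three typings — a CAUCHY ESTIMATE: the one-run envelope `G` at every
point of an admissible class (`ClassBound` / `TermBound`+`TermBudget`), complex differentiability along history segments
(`ClassLineAnalytic` / `TermHistLineAnalytic` ⇐ `TermHistExpLinear`), and SLACK — the two-margin box around every base point
inside the class (`BoxInClass`, discharged from the printed budget by DILATION `λ > 1` of the class, paid in the `ε₁`- and
`γ`-thresholds, `T4InputCauchyRateSpecies` §8 / NUMBERS (g″)) — giving the history modulus `G/(1 − ρ₀)` within RELATIVE REACH `ρ₀
< 1` of a base point, hence the a-priori NEAR REGIME (`hnear`: `(δ + δ′)θ^{k₀} + c(EA₀ + E₀)ω/(1 − ω) ≤ ρ₀`) and the smallness `ω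
+ G·c/(1 − ρ₀) < θ′`. Every one of reach, slack, room, dilation and the near regime is an artefact of estimating a DERIVATIVE from
VALUES on a disc. The seat's technique says "bound term-wise", and file v1.2 §6 already read the term LITERALLY: the potentials
enter the resummed term (2.14) p. 15 of [II] only through its last factor [R] *"exp[Σ_{Y∈𝐃} τ(Y)𝐕_k(Y,B)]"*, so a term is `∫
Φ(a)·exp(Λ(a) y) dμ(a)` in the history variable `y` with potential-free data. For SUCH a function the difference at two history
points needs no derivative at all: the secant of the exponential is controlled by its two ENDPOINT moduli (convexity of `t ↦
e^{Re}` along the segment), globally, with no smallness of the displacement. That is this leaf. The term-level device is not new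
in the cell: seat P2's `T4ActivityTilt` (operator AND history species at the level of ONE (2.14)-activity, polymer route) has the
tilt form `‖e^{−w} − 1‖ ≤ ‖w‖ max(1, e^{−Re w})` (`T4ActivityTilt.norm_cexp_neg_sub_one_le`), its integrated forms under a
FIELD-DEPENDENT domination `‖Δ‖ ≤ ρ·P` against first `P`-moments or tilted majorants (`norm_integral_tilt_sub_le_of_moments`,
`norm_integral_tilt_sub_le`) and a history leg `histLeg_of_tilt` — all cited here BY NAME, not imported (no cross-lineage version
entanglement); the uniform-`N` kernel of §1 is the case `P ≡ const` of P2's device and claims nothing beyond it. What THIS leaf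
adds is on the P1 ROUTE: the socket `TermHistLip` (ANY producer of termwise history moduli on class pairs — §3's, P2's, or
another), its first-moment sum `HistSecant`, the seat's scale recursion RE-PROVED with a reach-free history leg
(`recursiveRate_of_stepModel_secant`: the history half of `hnear`, the capped levels and `ω < 1` are gone; the operator species
keeps its reach `δθ^{k₀} ≤ ρ₀` and its constant-only wall `OpLipschitz`, W2-op, consumed as typed), the closures down to the
budget ball class WITHOUT room, and the deciding toy.

WHAT IS PROVED ([folklore] throughout). §1 KERNEL: `norm_cexp_sub_cexp_le : ‖cexp w − cexp z‖ ≤ ‖w − z‖ * (‖cexp z‖ + ‖cexp w‖)`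
for all `z w : ℂ`; integrability of `Φ·exp(Λ y)` and of its absolute value from `Integrable Φ`, weak measurability of `Λ` and an
a.e. operator-norm bound `‖Λ a‖ ≤ N` (`integrable_mul_cexp_clm`, `integrable_norm_mul_norm_cexp_clm`);
**`norm_integral_mul_cexp_sub_le`**: `‖∫ Φ·e^{Λ y′} − ∫ Φ·e^{Λ y}‖ ≤ N·‖y′ − y‖·(A(y) + A(y′))`, `A(y) = ∫ ‖Φ‖·‖e^{Λ y}‖` — for
ANY `y, y′`. §2 SHAPES over `(M, K, T)`: `HistSecant K κ Λhist` (class-wide history secant at equal operator datum, displacement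
in history margins, NO reach), `TermHistLip K T κ ℓ` (the same per term: the SOCKET), `histSecant_of_termHistLip : TermRep →
TermHistLip κ ℓ → TermBudget ℓ Λ → HistSecant κ Λ` (the budget summed is the FIRST-MOMENT budget of the moduli),
`termHistLip_mono`. §3 PRODUCER: `TermHistExpLinearN K T μ Φ Λ N` (file v1.2's `TermHistExpLinear` with the exponent bound NAMED,
in history margins: `‖Λ k i o X a‖·rHist k ≤ N k i` a.e.; `termHistExpLinear_of_N` recovers v1.2's shape, so its closures apply to
the same data), `ExpLinearAbsBound K κ a μ Φ Λ` (the ABSOLUTE majorant `∫ ‖Φ‖·‖e^{Λ q.2}‖ ≤ a k i·e^{−κd}` on the class;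
`termBound_of_expLinearAbs`: it is a `TermBound`), **`termHistLip_of_expLinear : TermHistExpLinearN … N → ExpLinearAbsBound … a →
(∀ k i, 0 ≤ N k i) → TermHistLip K T κ (2·N·a)`**, `termBudget_moment` (`Σᵢ Nᵢaᵢ ≤ G₁ ⟹ TermBudget (2Na) (2G₁)`),
`moment_of_uniform` (`0 ≤ Nᵢ ≤ N̄ ⟹ Σᵢ Nᵢaᵢ ≤ N̄·G`: the secant currency is at most `N̄` times the Cauchy face's majorant budget,
and every history-BLIND term, `Nᵢ = 0`, drops out), `histSecant_of_expLinear` (modulus `2G₁`). §4 RECURSION: `HistPairInClass K EA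
EB` (the leg's two endpoints — run A's operators with run B's inserted history, and run A's data point — lie in the class),
`HistBudgetA ctr EA BHistA` (run A's history budget about the class centre: the A-twin of `BaseBudget`'s history half),
`histPairInClass_ballClass` (budgets ⟹ endpoints in the ball class of radii `ROp ≥ BOp + δ·rOp`, `RHist ≥ max(BHist, BHistA)` —
the budgets THEMSELVES, no margin added; contrast `boxInClass_of_baseBudget`'s `BHist + rHist ≤ RHist`);
**`recursiveRate_of_stepModel_secant`**: the hypotheses of `T4InputCauchyRateSpecies.recursiveRate_of_stepModel_lip₂` with
`DataLipschitz₂ κ Λop Λhist ρ₀` replaced by `OpLipschitz κ Λop ρ₀ ∧ HistSecant K κ Λhist ∧ HistPairInClass K EA EB`, the near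
hypothesis replaced by the operator reach `δθ^{k₀} ≤ ρ₀` alone (no `ω < 1`), SAME conclusion `RecursiveRate EA EB W κ θ ω (Λop·δ +
Λhist·δ′ + B) (Λhist·c)` (proof: the triangle through the corner (run A's operators, run B's history) — operator leg within reach
at a base point, history leg class-wide); closures `ne5_at_of_stepModel_secant_nat` (smallness `ω + Λhist·c < θ′`, constant
`(Λop·δ + Λhist·δ′ + B)(θ′ − ω)/(θ′ − (ω + Λhist·c))` — the formulas of `ne5_at_of_stepModel_lip₂_nat` verbatim),
`exists_rate_of_stepModel_secant_nat`, `ne5_at_of_stepModel_secant_scale_nat` (W3 in its primitive typed form),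
`ne5_at_of_stepModel_termLip_scale_nat` (the socket form), `ne5_at_of_stepModel_expLinear_secant_scale_nat` (`Λhist = 2G₁`,
smallness `ω + 2G₁·c < θ′`), **`ne5_at_of_stepModel_expLinear_secant_budget_scale_nat`** (end to end on the budget ball class). §5
TOY (below).

THE PRICE AND THE GAIN, HONESTLY (cell wall sheet row W2-hist; census NUMBERS (h)). (α) GONE from the history species, as KERNEL
facts about the shapes: the reach `ρ₀` and with it the factor `1/(1 − ρ₀)`, the history half of the near regime
(`T4InputCauchyRateData` NUMBERS (d): `2γ₀ν_eff/(1 − ω) ≤ ρ₀ < 1`, the admissibility ceiling `ν_eff < 5/16` of (g″)), the slack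
`BoxInClass`, the room / dilation `λ` and its threshold prices `ε₁ ≤ ε̄₁/λ`, `γ ≤ γ̄/λ` (the class is the budget ball ITSELF: both
runs' potentials lie in it by their OWN budgets — Lemma 2 p. 11 of [II], the weighted norm (1.36), one run at a time, uniformly in
the lattice spacing; its reading about a common class centre is `BaseBudget` ∧ `HistBudgetA`, NOT PRINTED as such), and every
complex-differentiability hypothesis in the history species (`ClassLineAnalytic`, `TermHistLineAnalytic`, the holomorphy of v1.2
§6 — unused: the secant needs no derivative). (β) UNCHANGED: W2-op (`OpLipschitz κ Λop ρ₀`, constant-only, [analysis]: the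
operators enter the terms through contours, propagators and covariances, not exp-linearly; its reach `δθ^{k₀} ≤ ρ₀` is paid in
`k₀`/`B` only), the CLASS READING of the expansion (`TermRep` on the class: (2.13) p. 14 and its convergence p. 20, certified for
(2.41) by `READING-W2-CLASS-CERT.md`; NOT PRINTED as a statement over a class), the exp-linear STRUCTURE (`TermHistExpLinearN`:
the class reading of (2.14)'s last factor, [analysis]/DICTIONARY as in v1.2), W3 (`InsScaleBound κ E₁ c ω`), W1/W4 (the rates),
NE5 NOT PRINTED (G-t4-U3-1). (γ) THE NEW ENTRIES, and what print says near them: the ABSOLUTE majorants `a` (`ExpLinearAbsBound`)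
— [II]'s termwise estimate IS an estimate of the absolute integrand: (2.15) p. 15 bounds the term (2.14) with the potentials under
[R] *"exp[Σ_{Y∈𝐃} |τ(Y)||𝐕_k(Y,B)|]"*, and p. 20 sums the series [R] *"The series (2.13), defining 𝐄^{(k+1)}(X), is estimated in
the standard way, each factor |H(Z)| is replaced by the right-hand side of (2.38) in the bound."* — so `Σᵢ aᵢ` is of the level of
(2.41) p. 21, the class constant `G` of the Cauchy face (class reading; NOT PRINTED over a class); and the EXPONENT BOUNDS `N` in
history margins — the norm of `y ↦ Σ_Y τ(Y)·y(Y, B)` — whose printed relatives are the contour radii (2.18) p. 16 [R] *"We take a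
small, positive number α₄, to be chosen later, and"* [R] *"1/|τ(Y)| = E₀ε₁C₁α₄^{−1}M^q exp C₂κ₁ exp(−(1 − 3δ)κd_k(Y))."* (the
INVERSE of the potentials' unit level times `α₄`) and the estimate (2.20) p. 16 [R] *"Σ_{Y∈𝐃} |τ(Y)||V_k(Y, B)| ≤ ½Σ_{b,b′⊂Y₀}
α₄M^{−4}exp(−(1/16)(κ₁ − 1)M^{−1}|b₋ − b′₋|)|B(b)||B(b′)| + Σ_{Y∈𝐃} α₄exp(−δκd_k(Y)) ≤ ½O(1)α₄Σ_{b⊂Y₀}|B(b)|² +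
O(1)α₄M^{−4}|Y₀|."* — of the SIZE `α₄`, but FIELD- and VOLUME-dependent (`|B|²`, `|Y₀|`), absorbed in print into the Gaussian
`B`-integral and the decay factors (p. 17 [R] *"where α₅ = O(1)e^{−1/3δ₀M} + O(α₀ + α₁) + O(1)α₄ + γ₂. It is a Gaussian integral,
and can be easily calculated."*). A UNIFORM a.e. bound `N k i` per term is the reading of that absorption term by term
([analysis]; NOT PRINTED; the field-dependent form — domination `‖Δ‖ ≤ ρ·P` against `P`-moments — is exactly seat P2's
`T4ActivityTilt` device, the finer producer for the socket `TermHistLip`), and the first moment `G₁ = Σᵢ Nᵢaᵢ` is a resummation of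
the printed KIND ((2.25)/(2.29)-type), NOT PRINTED. Net: the secant face trades {reach, near regime, slack, dilation, thresholds
`/λ`, history analyticity} for {absolute majorants (printed kind, same level as `G`), exponent bounds `N` (printed kind, size
`α₄`, uniformity NOT PRINTED)}. Neither face is printed as a class statement; the wall sheet books them as ALTERNATIVE producers
of W2-hist.

NUMBERS (h) (this leaf; census currency S-ne5p1-sec, an ALTERNATIVE to S-ne5p1-λ of `T4InputCauchyRateSpecies` NUMBERS (g″), which
stands): by `ne5_at_of_stepModel_expLinear_secant_budget_scale_nat` the NE5 rate of the secant route is `max(θ_op, ω + 2G₁·c)` —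
no `ρ₀`, no `λ`, no `μ`. The product `G₁·c` is margin-gauge-INVARIANT (`N ∝ rHist`, `c ∝ 1/rHist`): in the dictionary of NUMBERS
(g) (`c = γ₀/rHist`, `γ₀ ≤ 1` the newest scale's share of the (1.36) budget; one-run output level `νE₀`, `ν = O(1)C₃ε₁/E₀ ∝ ε₁`,
[II] prints `ν ≤ ½` p. 21 [R] *"Next, we assume that O(1)C₃ε₁ ≤ ½E₀."*) it reads `G₁·c = γ₀·Σᵢ ‖Λᵢ‖·aᵢ` with `‖Λᵢ‖` the exponent's
norm per ABSOLUTE unit of potential; with `N̄ :=` the exponent worth of ONE FULL budget `E₀` of potential, uniformly over terms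
(NOT PRINTED; of printed size `O(1)α₄ ×` absorbed field/volume factors), `moment_of_uniform` gives `G₁·c ≤ γ₀N̄ν` and the
smallness `ω + 2γ₀N̄ν < θ′ = L^{−a}`. VALUES (`γ₀ = 1`, `L = 16`, `ω = 1/16`; §5 `example`): `N̄ν = 1/100`: `1/16 + 2/100 = 33/400
= 0.0825 < 479/5744 = 0.0834` (the (g″) row `λ = 2`, `μ = 1`, `ν = 1/100`) ⇒ `a < 0.899` against (g″)'s `a < 0.895` — the SAME
digits at `N̄ = 1`: the exponent gain of the secant face is the factor `(1 − ρ₀)·2N̄(λ − μ)/λ`, marginal unless `N̄ < 1`; its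
gains are STRUCTURAL — no admissibility ceiling (every `ν` with `ω + 2γ₀N̄ν < 1` has a rate; (g″) needs `ν_eff < 5/16`), no
threshold division, no near regime in the history species, and `a → ᾱ = 1` as `ε₁ → 0` as before (NUMBERS (a) is the floor of
every face). STATUS: constant-tracking inside hypothesis shapes; nothing in (h) is printed; NOT summit progress.

THE DECIDING TOY (§5). Carriers of `T4InputCauchyRate.toyCarriers`; `toyModelS` = file v5's `toyModel` (operators `(1/2)^k` versus
`0`, both runs insert "the previous scale with gain `1/64`", unit margins) with output `Out(o, h) = o + 100 + (e^h − 1)/8` — a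
history-BLIND bulk `100` plus a history-sensitive exponential of weight `1/8` — and base class `{o = 0, ‖h‖ ≤ 2}`; runs `E_B(k+1)
= 100 + (e^{E_B(k)/64} − 1)/8`, `E_A = E_B`'s recursion `+ (1/2)^k`, both in `[100, 102]`. (i) THE SECANT CLOSURE FIRES
(`toyS_ne5_secant`): three exp-linear terms `(o + 100, e^h/8, −1/8)` against Dirac data, exponent bounds `N = (0, 1, 0)`, absolute
majorants `a = (101, 1, 1)` on the ball class of radii `(1, 2)` = the budgets `(0 + 1·1, 2)` themselves, first moment `G₁ = 0·101
+ 1·1 + 0·1 = 1` (the bulk does NOT enter), `Λhist = 2`, exact operator leg `Λop = 1` (reach `ρ₀ = 1`, `k₀ = 0`, `B = 0`), `δ =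
1`, `δ′ = 0`, `c = ω = 1/64`, smallness `1/64 + 2·(1/64) = 3/64 < 1/2`: NE5 at rate `1/2` with constant `31/29`. (ii) EVERY
CAUCHY-FACED PRODUCER OF THE LINEAGE IS VOID on it: `toyS_not_boxInClass` (the secant class has no slack: the box around run B's
step-1 base point `(0, 100/64)` leaves radius `2`); `toyS_classBound_ge` (ANY class with slack and a class bound `G` has `100 ≤ G`
— the bulk is in every sup-norm constant), `toyS_termBudget_ge` (so has every termwise majorant budget, by
`classBound_of_termwise`), `toyS_histFibreEnvelopeCl_ge` / `toyS_histFibreEnvelope_ge` (so has every history fibre envelope);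
hence `toyS_cauchy_smallness_void`: `ω + G·c/(1 − ρ₀) ≥ 100/64 > 1 ≥ θ′` for every `ω ≥ 0`, `ρ₀ ∈ [0, 1)` — the smallness of
`T4InputCauchyRateSpecies.ne5_at_of_stepModel_{class,budget,fibre₂}_scale_nat` and of every `T4InputCauchyRateTermwise` closure
cannot hold at the toy's natural gain. (The Lipschitz-CONSUMING closures of file v5 / `…Species` §2 are not at issue: handed a
modulus they fire; the two faces are rival PRODUCERS of the modulus, and the toy separates them.)
-/

noncomputable section

open Metric Set Finset

namespace Literature.MathematicalPhysics.QuantumFieldTheory.Balaban1983to89.T4InputCauchyRateSecant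

open Literature.MathematicalPhysics.QuantumFieldTheory.Balaban1983to89.T4OutputRate
open Literature.MathematicalPhysics.QuantumFieldTheory.Balaban1983to89.T4InputCauchyRate
open Literature.MathematicalPhysics.QuantumFieldTheory.Balaban1983to89.T4InputCauchyRateData
open Literature.MathematicalPhysics.QuantumFieldTheory.Balaban1983to89.T4InputCauchyRateSpecies
open Literature.MathematicalPhysics.QuantumFieldTheory.Balaban1983to89.T4InputCauchyRateTermwise

/-! ## §1 The kernel: the secant of the exponential, and of an exp-linear integral, WITHOUT a reach condition -/

section Kernel

open _root_.MeasureTheory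

/-- **SECANT BOUND FOR THE COMPLEX EXPONENTIAL** [folklore]: `‖e^w − e^z‖ ≤ ‖w − z‖·(‖e^z‖ + ‖e^w‖)` for ALL `z, w ∈ ℂ` —
the mean value inequality along the segment `t ↦ e^{z + t(w − z)}`, whose speed `e^{Re(z + t(w−z))}‖w − z‖` is, by
convexity of `Re` along the segment, at most `max(e^{Re z}, e^{Re w})‖w − z‖`.  No smallness of `‖w − z‖` (contrast
`Complex.norm_exp_sub_one_le`-type bounds, which need `‖w − z‖ ≤ 1`): the two ENDPOINT moduli pay for the whole
segment.  (The tilt form `‖e^{−w} − 1‖ ≤ ‖w‖ max(1, e^{−Re w})` of the same inequality is seat P2's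
`T4ActivityTilt.norm_cexp_neg_sub_one_le`, cited BY NAME, not imported.) -/
theorem norm_cexp_sub_cexp_le (z w : ℂ) :
    ‖Complex.exp w - Complex.exp z‖ ≤ ‖w - z‖ * (‖Complex.exp z‖ + ‖Complex.exp w‖) := by
  set e : ℂ → ℂ := fun s => Complex.exp (z + s * (w - z)) with he
  have hed : ∀ s : ℂ, HasDerivAt e (Complex.exp (z + s * (w - z)) * (w - z)) s := by
    intro s
    have h1 : HasDerivAt (fun s : ℂ => z + s * (w - z)) (1 * (w - z)) s :=
      ((hasDerivAt_id s).mul_const (w - z)).const_add z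
    rw [one_mul] at h1
    exact (Complex.hasDerivAt_exp _).comp s h1
  have hf : ∀ t ∈ Icc (0 : ℝ) 1, HasDerivWithinAt (fun t : ℝ => e (t : ℂ))
      (Complex.exp (z + (t : ℂ) * (w - z)) * (w - z)) (Icc (0 : ℝ) 1) t :=
    fun t _ => (hed (t : ℂ)).comp_ofReal.hasDerivWithinAt
  have hbound : ∀ t ∈ Ico (0 : ℝ) 1,
      ‖Complex.exp (z + (t : ℂ) * (w - z)) * (w - z)‖ ≤ ‖w - z‖ * (‖Complex.exp z‖ + ‖Complex.exp w‖) := by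
    intro t ht
    rw [norm_mul, Complex.norm_exp, Complex.norm_exp, Complex.norm_exp, mul_comm]
    refine mul_le_mul_of_nonneg_left ?_ (norm_nonneg _)
    have hre : (z + (t : ℂ) * (w - z)).re = (1 - t) * z.re + t * w.re := by
      simp only [Complex.add_re, Complex.mul_re, Complex.sub_re, Complex.sub_im, Complex.ofReal_re,
        Complex.ofReal_im, zero_mul, sub_zero]
      ring
    rw [hre]
    rcases le_total z.re w.re with h | h
    · have h' : (1 - t) * z.re + t * w.re ≤ w.re := by nlinarith [ht.1, ht.2]
      calc Real.exp ((1 - t) * z.re + t * w.re) ≤ Real.exp w.re := Real.exp_le_exp.mpr h'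
        _ ≤ Real.exp z.re + Real.exp w.re := le_add_of_nonneg_left (Real.exp_pos _).le
    · have h' : (1 - t) * z.re + t * w.re ≤ z.re := by nlinarith [ht.1, ht.2]
      calc Real.exp ((1 - t) * z.re + t * w.re) ≤ Real.exp z.re := Real.exp_le_exp.mpr h'
        _ ≤ Real.exp z.re + Real.exp w.re := le_add_of_nonneg_right (Real.exp_pos _).le
  have h := norm_image_sub_le_of_norm_deriv_le_segment_01' hf hbound
  simpa [he] using h

variable {H : Type*} [NormedAddCommGroup H] [NormedSpace ℂ H]

/-- Integrability of an exp-linear integrand `a ↦ Φ(a)·exp(Λ(a) y)` from the integrability of the weight, the weak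
measurability of the exponents and their a.e. operator-norm bound (domination by `‖Φ‖·e^{N‖y‖}`,
`T4InputCauchyRateTermwise.norm_mul_cexp_clm_le`). [folklore] -/
theorem integrable_mul_cexp_clm {α : Type*} [MeasurableSpace α] {μ : Measure α} {Φ : α → ℂ}
    {Λ : α → H →L[ℂ] ℂ} {N : ℝ} (hΦ : Integrable Φ μ) (hΛm : ∀ y, AEStronglyMeasurable (fun a => Λ a y) μ)
    (hΛ : ∀ᵐ a ∂μ, ‖Λ a‖ ≤ N) (y : H) : Integrable (fun a => Φ a * Complex.exp (Λ a y)) μ := by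
  refine (hΦ.norm.mul_const (Real.exp (N * ‖y‖))).mono'
    (hΦ.aestronglyMeasurable.mul (Complex.continuous_exp.comp_aestronglyMeasurable (hΛm y))) ?_
  filter_upwards [hΛ] with a ha using norm_mul_cexp_clm_le ha y

/-- Integrability of the ABSOLUTE majorant `a ↦ ‖Φ(a)‖·‖exp(Λ(a) y)‖` under the same data. [folklore] -/
theorem integrable_norm_mul_norm_cexp_clm {α : Type*} [MeasurableSpace α] {μ : Measure α} {Φ : α → ℂ}
    {Λ : α → H →L[ℂ] ℂ} {N : ℝ} (hΦ : Integrable Φ μ) (hΛm : ∀ y, AEStronglyMeasurable (fun a => Λ a y) μ)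
    (hΛ : ∀ᵐ a ∂μ, ‖Λ a‖ ≤ N) (y : H) :
    Integrable (fun a => ‖Φ a‖ * ‖Complex.exp (Λ a y)‖) μ := by
  have h := (integrable_mul_cexp_clm hΦ hΛm hΛ y).norm
  refine h.congr (Filter.Eventually.of_forall fun a => ?_)
  simp only [norm_mul]

/-- **SECANT BOUND FOR AN EXP-LINEAR INTEGRAL** [folklore] — the kernel of this leaf: if the exponents are a.e. bounded
in operator norm, `‖Λ(a)‖ ≤ N`, then for ANY two values `y, y′` of the linear variable
`‖∫ Φ·e^{Λ y′} dμ − ∫ Φ·e^{Λ y} dμ‖ ≤ N‖y′ − y‖·(A(y) + A(y′))`, `A(y) = ∫ ‖Φ‖·‖e^{Λ y}‖ dμ` the ABSOLUTE majorant AT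
THE ENDPOINTS — `norm_cexp_sub_cexp_le` under the integral sign.  No reach condition, no disc, no Cauchy estimate: the
modulus is LINEAR in the exponent bound `N` and in the endpoint majorants.  (Seat P2's tilt lemma
`T4ActivityTilt.norm_integral_tilt_sub_le_of_moments` is the finer device of the same kind — a FIELD-DEPENDENT domination
`‖Δ‖ ≤ ρP` of the exponent difference against first `P`-moments — of which the present uniform-`N` form is the case
`P ≡ const`; cited BY NAME, not imported.) -/
theorem norm_integral_mul_cexp_sub_le {α : Type*} [MeasurableSpace α] (μ : Measure α) (Φ : α → ℂ)
    (Λ : α → H →L[ℂ] ℂ) {N : ℝ} (hΦ : Integrable Φ μ) (hΛm : ∀ y, AEStronglyMeasurable (fun a => Λ a y) μ)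
    (hΛ : ∀ᵐ a ∂μ, ‖Λ a‖ ≤ N) (y y' : H) :
    ‖(∫ a, Φ a * Complex.exp (Λ a y') ∂μ) - ∫ a, Φ a * Complex.exp (Λ a y) ∂μ‖
      ≤ N * ‖y' - y‖ * ((∫ a, ‖Φ a‖ * ‖Complex.exp (Λ a y)‖ ∂μ) + ∫ a, ‖Φ a‖ * ‖Complex.exp (Λ a y')‖ ∂μ) := by
  have hI := integrable_norm_mul_norm_cexp_clm hΦ hΛm hΛ y
  have hI' := integrable_norm_mul_norm_cexp_clm hΦ hΛm hΛ y'
  rw [← integral_sub (integrable_mul_cexp_clm hΦ hΛm hΛ y') (integrable_mul_cexp_clm hΦ hΛm hΛ y)]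
  have hpt : ∀ᵐ a ∂μ, ‖Φ a * Complex.exp (Λ a y') - Φ a * Complex.exp (Λ a y)‖
      ≤ N * ‖y' - y‖ * (‖Φ a‖ * ‖Complex.exp (Λ a y)‖ + ‖Φ a‖ * ‖Complex.exp (Λ a y')‖) := by
    filter_upwards [hΛ] with a ha
    rw [← mul_sub, norm_mul]
    have hsec := norm_cexp_sub_cexp_le (Λ a y) (Λ a y')
    have hlin : ‖Λ a y' - Λ a y‖ ≤ N * ‖y' - y‖ := by
      rw [← map_sub]
      exact (Λ a).le_of_opNorm_le ha _
    have hE : 0 ≤ ‖Complex.exp (Λ a y)‖ + ‖Complex.exp (Λ a y')‖ := by positivity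
    calc ‖Φ a‖ * ‖Complex.exp (Λ a y') - Complex.exp (Λ a y)‖
        ≤ ‖Φ a‖ * (N * ‖y' - y‖ * (‖Complex.exp (Λ a y)‖ + ‖Complex.exp (Λ a y')‖)) :=
          mul_le_mul_of_nonneg_left (hsec.trans (mul_le_mul_of_nonneg_right hlin hE)) (norm_nonneg _)
      _ = N * ‖y' - y‖ * (‖Φ a‖ * ‖Complex.exp (Λ a y)‖ + ‖Φ a‖ * ‖Complex.exp (Λ a y')‖) := by ring
  have hg : Integrable (fun a => N * ‖y' - y‖ * (‖Φ a‖ * ‖Complex.exp (Λ a y)‖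
      + ‖Φ a‖ * ‖Complex.exp (Λ a y')‖)) μ := (hI.add hI').const_mul _
  calc ‖∫ a, (Φ a * Complex.exp (Λ a y') - Φ a * Complex.exp (Λ a y)) ∂μ‖
      ≤ ∫ a, N * ‖y' - y‖ * (‖Φ a‖ * ‖Complex.exp (Λ a y)‖ + ‖Φ a‖ * ‖Complex.exp (Λ a y')‖) ∂μ :=
        norm_integral_le_of_norm_le hg hpt
    _ = N * ‖y' - y‖ * ((∫ a, ‖Φ a‖ * ‖Complex.exp (Λ a y)‖ ∂μ) + ∫ a, ‖Φ a‖ * ‖Complex.exp (Λ a y')‖ ∂μ) := by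
        rw [integral_const_mul, integral_add hI hI']

end Kernel

/-! ## §2 The shapes: a termwise history modulus on class pairs, its first-moment sum, the class-wide history secant -/

section Shapes

variable {C : Carriers} {Op Hist : Type*} [NormedAddCommGroup Op] [NormedSpace ℂ Op] [NormedAddCommGroup Hist]
  [NormedSpace ℂ Hist] {ι : Type*} (M : StepModel C Op Hist) (K : ℕ → (ℕ → ℝ) → C.BgB → Set (Op × Hist))
  (T : ℕ → ι → Op → Hist → C.Dom → ℂ)

/-- HYPOTHESIS SHAPE `HistSecant K κ Λhist` (NOT PRINTED; the CLASS-WIDE SECANT FACE of wall W2-hist): for ANY two class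
points with the SAME operator datum, the step-`k` output at a step-`k` domain differs by at most
`Λhist·(‖h′ − h‖/rHist)·e^{−κd(X)}` — a history-species modulus valid across the whole class, with NO reach condition
(contrast `T4InputCauchyRateSpecies.DataLipschitz₂` / `HistFibreEnvelope`: moduli within `ρ₀ < 1` margins of a base
point, from a Cauchy estimate on the slack box). [folklore] -/
def HistSecant (W : Set (ℕ → ℝ)) (κ Λhist : ℝ) : Prop :=
  ∀ k, ∀ g ∈ W, ∀ (U : C.BgB) (o : Op) (h h' : Hist), (o, h) ∈ K k g U → (o, h') ∈ K k g U →
    ∀ X : C.Dom, C.scale X = k →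
      ‖M.Out k o h' X - M.Out k o h X‖ ≤ Λhist * (‖h' - h‖ / M.rHist k) * Real.exp (-(κ * C.d X))

/-- HYPOTHESIS SHAPE `TermHistLip K T κ ℓ` (NOT PRINTED; the TERMWISE history modulus — the SOCKET of this leaf): for any
two class points with the same operator datum, term `i` of the expansion at a step-`k` domain differs by at most
`ℓ k i·(‖h′ − h‖/rHist)·e^{−κd(X)}`.  Producers: §3 (exp-linear terms with uniformly bounded exponents: `ℓ = 2Na`, the
exponent bound times the absolute majorant), seat P2's tilt lemma `T4ActivityTilt.histLeg_of_tilt` (field-dependent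
domination; by name), or any other termwise device. [folklore] -/
def TermHistLip (W : Set (ℕ → ℝ)) (κ : ℝ) (ℓ : ℕ → ι → ℝ) : Prop :=
  ∀ k, ∀ g ∈ W, ∀ (U : C.BgB) (o : Op) (h h' : Hist), (o, h) ∈ K k g U → (o, h') ∈ K k g U →
    ∀ X : C.Dom, C.scale X = k →
      ∀ i, ‖T k i o h' X - T k i o h X‖ ≤ ℓ k i * (‖h' - h‖ / M.rHist k) * Real.exp (-(κ * C.d X))

variable {M K T}

/-- **TERMWISE MODULI ⟹ CLASS-WIDE SECANT**: `TermRep ∧ TermHistLip κ ℓ ∧ TermBudget ℓ Λ ⟹ HistSecant κ Λ` — the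
difference of two convergent sums is the sum of the differences, whose norm is at most the sum of the termwise moduli
(`HasSum.sub`, `HasSum.norm_le_of_bounded`).  The budget summed is the FIRST-MOMENT budget `Σᵢ ℓ k i ≤ Λ` of the moduli,
not the class constant `G` of the values. [folklore] -/
theorem histSecant_of_termHistLip {W : Set (ℕ → ℝ)} {κ Λ : ℝ} {ℓ : ℕ → ι → ℝ} (hrep : TermRep M K T W)
    (hlip : TermHistLip M K T W κ ℓ) (hbud : TermBudget ℓ Λ) : HistSecant M K W κ Λ := by
  intro k g hg U o h h' hq hq' X hX
  have hs : HasSum (fun i => T k i o h' X - T k i o h X) (M.Out k o h' X - M.Out k o h X) :=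
    (hrep k g hg U (o, h') hq' X hX).sub (hrep k g hg U (o, h) hq X hX)
  have h1 : ‖M.Out k o h' X - M.Out k o h X‖ ≤ (∑' i, ℓ k i) * ((‖h' - h‖ / M.rHist k) * Real.exp (-(κ * C.d X))) :=
    hs.norm_le_of_bounded ((hbud k).1.hasSum.mul_right _) fun i => by
      rw [← mul_assoc]; exact hlip k g hg U o h h' hq hq' X hX i
  have hnn : 0 ≤ (‖h' - h‖ / M.rHist k) * Real.exp (-(κ * C.d X)) :=
    mul_nonneg (div_nonneg (norm_nonneg _) (M.rHist_pos k).le) (Real.exp_pos _).le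
  calc ‖M.Out k o h' X - M.Out k o h X‖ ≤ (∑' i, ℓ k i) * ((‖h' - h‖ / M.rHist k) * Real.exp (-(κ * C.d X))) := h1
    _ ≤ Λ * ((‖h' - h‖ / M.rHist k) * Real.exp (-(κ * C.d X))) := mul_le_mul_of_nonneg_right (hbud k).2 hnn
    _ = Λ * (‖h' - h‖ / M.rHist k) * Real.exp (-(κ * C.d X)) := by ring

/-- A termwise modulus family dominated by another is still a modulus family (monotonicity in `ℓ`). [folklore] -/
theorem termHistLip_mono {W : Set (ℕ → ℝ)} {κ : ℝ} {ℓ ℓ' : ℕ → ι → ℝ} (h : TermHistLip M K T W κ ℓ)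
    (hle : ∀ k i, ℓ k i ≤ ℓ' k i) : TermHistLip M K T W κ ℓ' :=
  fun k g hg U o h₀ h₁ hq hq' X hX i => (h k g hg U o h₀ h₁ hq hq' X hX i).trans
    (mul_le_mul_of_nonneg_right (mul_le_mul_of_nonneg_right (hle k i)
      (div_nonneg (norm_nonneg _) (M.rHist_pos k).le)) (Real.exp_pos _).le)

end Shapes

/-! ## §3 The producer: exp-linear terms with exponents bounded in margin units and ABSOLUTE majorants -/

section ExpLinearSecant

open _root_.MeasureTheory

variable {C : Carriers} {Op Hist : Type*} [NormedAddCommGroup Op] [NormedSpace ℂ Op] [NormedAddCommGroup Hist]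
  [NormedSpace ℂ Hist] {ι : Type*} (M : StepModel C Op Hist) (K : ℕ → (ℕ → ℝ) → C.BgB → Set (Op × Hist))
  (T : ℕ → ι → Op → Hist → C.Dom → ℂ)

/-- HYPOTHESIS SHAPE `TermHistExpLinearN K T μ Φ Λ N` ([analysis]/DICTIONARY exactly as
`T4InputCauchyRateTermwise.TermHistExpLinear`, with its existential exponent bound replaced by a NAMED bound IN HISTORY
MARGIN UNITS: `‖Λ k i o X a‖·rHist k ≤ N k i` a.e. — the number of history margins one unit of the exponent's linear
variable is worth; [analysis] for [II]: the `τ(Y)` of (2.14) p. 15 lie on the circles (2.18) p. 16 whose radius is the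
INVERSE of the potentials' unit level, so `N` is of the KIND of the printed termwise estimate (2.20) p. 16 — carrying the
small factor `α₄`, there FIELD- and VOLUME-dependent and absorbed into the Gaussian integral and the decay factors on
pp. 16–17; a UNIFORM bound per term is the reading of that absorption, the field-dependent form being seat P2's
`T4ActivityTilt` domination, by name — and NOT of the kind of the class constant; NOT PRINTED as a statement over a class):
term `i` at every
class point is `∫ Φ(a)·exp(Λ(a) q.2) dμ(a)` with integrable weight, weakly measurable exponents independent of the history
point, and the named a.e. bound. [folklore] -/
def TermHistExpLinearN (W : Set (ℕ → ℝ)) {α : ℕ → ι → Type*} [∀ k i, MeasurableSpace (α k i)]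
    (μ : ∀ k i, Op → C.Dom → Measure (α k i)) (Φ : ∀ k i, Op → C.Dom → α k i → ℂ)
    (Λ : ∀ k i, Op → C.Dom → α k i → (Hist →L[ℂ] ℂ)) (N : ℕ → ι → ℝ) : Prop :=
  ∀ k, ∀ g ∈ W, ∀ (U : C.BgB) (q : Op × Hist), q ∈ K k g U → ∀ X : C.Dom, C.scale X = k → ∀ i,
    Integrable (Φ k i q.1 X) (μ k i q.1 X) ∧
      (∀ y : Hist, AEStronglyMeasurable (fun a => Λ k i q.1 X a y) (μ k i q.1 X)) ∧
        (∀ᵐ a ∂(μ k i q.1 X), ‖Λ k i q.1 X a‖ * M.rHist k ≤ N k i) ∧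
          T k i q.1 q.2 X = ∫ a, Φ k i q.1 X a * Complex.exp (Λ k i q.1 X a q.2) ∂(μ k i q.1 X)

/-- HYPOTHESIS SHAPE `ExpLinearAbsBound K κ a μ Φ Λ` (printed SUPPORT of the same standing as
`T4InputCauchyRateTermwise.TermBound`: the termwise estimate of [II] IS an estimate of the ABSOLUTE integrand — (2.15)
p. 15 bounds the modulus of the term (2.14) by the integral of the moduli, the potentials entering through
`exp[Σ_{Y∈𝐃} |τ(Y)||𝐕_k(Y,B)|]`; NOT PRINTED as a statement over a class): at every class point the ABSOLUTE majorant of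
term `i`, `∫ ‖Φ(a)‖·‖exp(Λ(a) q.2)‖ dμ(a)`, is at most `a k i·e^{−κd(X)}`. [folklore] -/
def ExpLinearAbsBound (W : Set (ℕ → ℝ)) (κ : ℝ) (a : ℕ → ι → ℝ) {α : ℕ → ι → Type*} [∀ k i, MeasurableSpace (α k i)]
    (μ : ∀ k i, Op → C.Dom → Measure (α k i)) (Φ : ∀ k i, Op → C.Dom → α k i → ℂ)
    (Λ : ∀ k i, Op → C.Dom → α k i → (Hist →L[ℂ] ℂ)) : Prop :=
  ∀ k, ∀ g ∈ W, ∀ (U : C.BgB) (q : Op × Hist), q ∈ K k g U → ∀ X : C.Dom, C.scale X = k → ∀ i,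
    ∫ a, ‖Φ k i q.1 X a‖ * ‖Complex.exp (Λ k i q.1 X a q.2)‖ ∂(μ k i q.1 X) ≤ a k i * Real.exp (-(κ * C.d X))

variable {M K T}

/-- The named-bound shape implies file v1.2's existential one (so every closure of `T4InputCauchyRateTermwise` §7 still
applies to the same data). [folklore] -/
theorem termHistExpLinear_of_N {W : Set (ℕ → ℝ)} {α : ℕ → ι → Type*} [∀ k i, MeasurableSpace (α k i)]
    {μ : ∀ k i, Op → C.Dom → Measure (α k i)} {Φ : ∀ k i, Op → C.Dom → α k i → ℂ}
    {Λ : ∀ k i, Op → C.Dom → α k i → (Hist →L[ℂ] ℂ)} {N : ℕ → ι → ℝ} (h : TermHistExpLinearN M K T W μ Φ Λ N) :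
    TermHistExpLinear K T W μ Φ Λ := by
  intro k g hg U q hq X hX i
  obtain ⟨hΦ, hΛm, hN, hT⟩ := h k g hg U q hq X hX i
  refine ⟨hΦ, hΛm, ⟨N k i / M.rHist k, ?_⟩, hT⟩
  filter_upwards [hN] with a ha
  rwa [le_div_iff₀ (M.rHist_pos k)]

/-- **ABSOLUTE MAJORANTS ARE MAJORANTS**: `TermHistExpLinearN ∧ ExpLinearAbsBound κ a ⟹ TermBound κ a` (the norm of the
integral is at most the integral of the norm) — so the absolute reading of the printed termwise bound feeds
`classBound_of_termwise` and everything downstream of it unchanged. [folklore] -/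
theorem termBound_of_expLinearAbs {W : Set (ℕ → ℝ)} {κ : ℝ} {a : ℕ → ι → ℝ} {α : ℕ → ι → Type*}
    [∀ k i, MeasurableSpace (α k i)] {μ : ∀ k i, Op → C.Dom → Measure (α k i)}
    {Φ : ∀ k i, Op → C.Dom → α k i → ℂ} {Λ : ∀ k i, Op → C.Dom → α k i → (Hist →L[ℂ] ℂ)} {N : ℕ → ι → ℝ}
    (hexp : TermHistExpLinearN M K T W μ Φ Λ N) (habs : ExpLinearAbsBound K W κ a μ Φ Λ) : TermBound K T W κ a := by
  intro k g hg U q hq X hX i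
  obtain ⟨hΦ, hΛm, hN, hT⟩ := hexp k g hg U q hq X hX i
  rw [hT]
  refine (norm_integral_le_integral_norm _).trans (le_trans (le_of_eq ?_) (habs k g hg U q hq X hX i))
  exact integral_congr_ae (Filter.Eventually.of_forall fun x => norm_mul _ _)

/-- **THE PRODUCER**: exp-linear terms whose exponents are worth at most `N k i` history margins and whose ABSOLUTE
majorants are `≤ a k i·e^{−κd}` on the class have the termwise history modulus `ℓ = 2·N·a` —
`norm_integral_mul_cexp_sub_le` between the two class points `(o, h)`, `(o, h′)`, each endpoint majorant `≤ a k i·e^{−κd}`.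
The factor `2` is the two endpoints; nothing else enters. [folklore] -/
theorem termHistLip_of_expLinear {W : Set (ℕ → ℝ)} {κ : ℝ} {a N : ℕ → ι → ℝ} {α : ℕ → ι → Type*}
    [∀ k i, MeasurableSpace (α k i)] {μ : ∀ k i, Op → C.Dom → Measure (α k i)}
    {Φ : ∀ k i, Op → C.Dom → α k i → ℂ} {Λ : ∀ k i, Op → C.Dom → α k i → (Hist →L[ℂ] ℂ)}
    (hexp : TermHistExpLinearN M K T W μ Φ Λ N) (habs : ExpLinearAbsBound K W κ a μ Φ Λ) (hN0 : ∀ k i, 0 ≤ N k i) :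
    TermHistLip M K T W κ (fun k i => 2 * N k i * a k i) := by
  intro k g hg U o h h' hq hq' X hX i
  obtain ⟨hΦ, hΛm, hN, hT⟩ := hexp k g hg U (o, h) hq X hX i
  obtain ⟨-, -, -, hT'⟩ := hexp k g hg U (o, h') hq' X hX i
  have hA := habs k g hg U (o, h) hq X hX i
  have hA' := habs k g hg U (o, h') hq' X hX i
  simp only at hT hT' hA hA' hΦ hΛm hN
  have hrH := M.rHist_pos k
  have hN' : ∀ᵐ x ∂(μ k i o X), ‖Λ k i o X x‖ ≤ N k i / M.rHist k := by
    filter_upwards [hN] with x hx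
    rwa [le_div_iff₀ hrH]
  have hNnn : 0 ≤ N k i / M.rHist k := div_nonneg (hN0 k i) hrH.le
  rw [hT, hT']
  have key := norm_integral_mul_cexp_sub_le (μ k i o X) (Φ k i o X) (Λ k i o X) hΦ hΛm hN' h h'
  refine key.trans ?_
  have hsum : (∫ x, ‖Φ k i o X x‖ * ‖Complex.exp (Λ k i o X x h)‖ ∂(μ k i o X)) +
      ∫ x, ‖Φ k i o X x‖ * ‖Complex.exp (Λ k i o X x h')‖ ∂(μ k i o X) ≤ 2 * (a k i * Real.exp (-(κ * C.d X))) := by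
    linarith
  calc N k i / M.rHist k * ‖h' - h‖ * ((∫ x, ‖Φ k i o X x‖ * ‖Complex.exp (Λ k i o X x h)‖ ∂(μ k i o X)) +
        ∫ x, ‖Φ k i o X x‖ * ‖Complex.exp (Λ k i o X x h')‖ ∂(μ k i o X))
      ≤ N k i / M.rHist k * ‖h' - h‖ * (2 * (a k i * Real.exp (-(κ * C.d X)))) :=
        mul_le_mul_of_nonneg_left hsum (mul_nonneg hNnn (norm_nonneg _))
    _ = 2 * N k i * a k i * (‖h' - h‖ / M.rHist k) * Real.exp (-(κ * C.d X)) := by ring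

/-- The first-moment budget: if `Σᵢ N k i·a k i ≤ G₁` at every step then `TermBudget (2Na) (2G₁)`. [folklore] -/
theorem termBudget_moment {a N : ℕ → ι → ℝ} {G₁ : ℝ} (h : ∀ k, Summable (fun i => N k i * a k i) ∧
    ∑' i, N k i * a k i ≤ G₁) : TermBudget (fun k i => 2 * N k i * a k i) (2 * G₁) := by
  intro k
  obtain ⟨hs, hle⟩ := h k
  have e : ∑' i, 2 * N k i * a k i = 2 * ∑' i, N k i * a k i := by
    rw [← tsum_mul_left]; exact tsum_congr fun i => by ring
  refine ⟨(hs.mul_left 2).congr fun i => by ring, ?_⟩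
  rw [e]; linarith

/-- **UNIFORM EXPONENT BOUND ⟹ FIRST MOMENT ≤ `N̄` × MAJORANT BUDGET**: if `0 ≤ Nᵢ ≤ N̄` and `0 ≤ aᵢ` with
`TermBudget a G`, then `Σᵢ Nᵢaᵢ` converges and is `≤ N̄·G` — the secant currency is never worse than `N̄` times the
majorant budget of the Cauchy face (`T4InputCauchyRateTermwise.TermBudget`), and every history-BLIND term (`Nᵢ = 0`)
drops out of it. [folklore] -/
theorem moment_of_uniform {a N : ℕ → ι → ℝ} {G Nbar : ℝ} (hN0 : ∀ k i, 0 ≤ N k i) (hN : ∀ k i, N k i ≤ Nbar)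
    (hNbar : 0 ≤ Nbar) (ha : ∀ k i, 0 ≤ a k i) (hbud : TermBudget a G) (k : ℕ) :
    Summable (fun i => N k i * a k i) ∧ ∑' i, N k i * a k i ≤ Nbar * G := by
  have hle : ∀ i, N k i * a k i ≤ Nbar * a k i := fun i => mul_le_mul_of_nonneg_right (hN k i) (ha k i)
  have hs : Summable (fun i => Nbar * a k i) := (hbud k).1.mul_left Nbar
  have h1 : Summable (fun i => N k i * a k i) :=
    Summable.of_nonneg_of_le (fun i => mul_nonneg (hN0 k i) (ha k i)) hle hs
  refine ⟨h1, ?_⟩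
  calc ∑' i, N k i * a k i ≤ ∑' i, Nbar * a k i := h1.tsum_le_tsum hle hs
    _ = Nbar * ∑' i, a k i := tsum_mul_left
    _ ≤ Nbar * G := mul_le_mul_of_nonneg_left (hbud k).2 hNbar

/-- **EXP-LINEAR DATA ⟹ CLASS-WIDE HISTORY SECANT with modulus `2G₁`** (`G₁` the first-moment budget of exponent bound ×
absolute majorant): the composite `histSecant_of_termHistLip ∘ termHistLip_of_expLinear ∘ termBudget_moment`.
[folklore] -/
theorem histSecant_of_expLinear {W : Set (ℕ → ℝ)} {κ G₁ : ℝ} {a N : ℕ → ι → ℝ} {α : ℕ → ι → Type*}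
    [∀ k i, MeasurableSpace (α k i)] {μ : ∀ k i, Op → C.Dom → Measure (α k i)}
    {Φ : ∀ k i, Op → C.Dom → α k i → ℂ} {Λ : ∀ k i, Op → C.Dom → α k i → (Hist →L[ℂ] ℂ)} (hrep : TermRep M K T W)
    (hexp : TermHistExpLinearN M K T W μ Φ Λ N) (habs : ExpLinearAbsBound K W κ a μ Φ Λ) (hN0 : ∀ k i, 0 ≤ N k i)
    (hmom : ∀ k, Summable (fun i => N k i * a k i) ∧ ∑' i, N k i * a k i ≤ G₁) : HistSecant M K W κ (2 * G₁) :=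
  histSecant_of_termHistLip hrep (termHistLip_of_expLinear hexp habs hN0) (termBudget_moment hmom)

end ExpLinearSecant

/-! ## §4 The recursion with a REACH-FREE history leg, and the closures -/

section Recursion

variable {C : Carriers} {Op Hist : Type*} [NormedAddCommGroup Op] [NormedSpace ℂ Op] [NormedAddCommGroup Hist]
  [NormedSpace ℂ Hist] {ι : Type*} (M : StepModel C Op Hist) (K : ℕ → (ℕ → ℝ) → C.BgB → Set (Op × Hist))

/-- HYPOTHESIS SHAPE `HistPairInClass K EA EB` (NOT PRINTED; what the secant recursion needs of the class IN PLACE OF the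
slack `BoxInClass` of `T4InputCauchyRateSpecies` §6): at every step the two ENDPOINTS of the history leg — run A's operators
with run B's inserted history, and run A's own data point — lie in the class.  Discharged for a ball class from the two
runs' history BUDGETS and the operator rate by `histPairInClass_ballClass` (no margin, no room inequality in the history
species). [folklore] -/
def HistPairInClass (EA : Functional C C.BgA) (EB : Functional C C.BgB) (W : Set (ℕ → ℝ)) : Prop :=
  ∀ k, ∀ g ∈ W, ∀ U : C.BgB, (M.opA g U k, (M.dataB EB g U k).2) ∈ K k g U ∧ M.dataA EA g U k ∈ K k g U

/-- HYPOTHESIS SHAPE `HistBudgetA ctr EA BHistA` (printed SUPPORT, ONE run: the A-twin of the history half of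
`T4InputCauchyRateSpecies.BaseBudget` — [II] Lemma 2 p. 11 places each run's OWN total potential in the budget ball of the
weighted norm (1.36) p. 9, uniformly in the lattice spacing; NOT PRINTED as a statement about a class centre): run A's
inserted history at step `k` lies within `BHistA k` of the class centre's history component. [folklore] -/
def HistBudgetA (ctr : ℕ → (ℕ → ℝ) → C.BgB → Op × Hist) (EA : Functional C C.BgA) (W : Set (ℕ → ℝ))
    (BHistA : ℕ → ℝ) : Prop :=
  ∀ k, ∀ g ∈ W, ∀ U : C.BgB, ‖(M.dataA EA g U k).2 - (ctr k g U).2‖ ≤ BHistA k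

variable {M K}

/-- **BUDGETS ⟹ THE LEG'S ENDPOINTS LIE IN THE BALL CLASS** — with NO room in the history species: radii
`ROp ≥ BOp + δ·rOp` (run A's operators sit `δθ^k ≤ δ` operator margins off run B's, which sit within budget `BOp` of the
centre) and `RHist ≥ max(BHist, BHistA)` (the two runs' history budgets THEMSELVES — contrast the room inequality
`BHist + rHist ≤ RHist` of `T4InputCauchyRateSpecies.boxInClass_of_baseBudget`). [folklore] -/
theorem histPairInClass_ballClass {W : Set (ℕ → ℝ)} {ctr : ℕ → (ℕ → ℝ) → C.BgB → Op × Hist}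
    {BOp BHist BHistA ROp RHist : ℕ → ℝ} {EA : Functional C C.BgA} {EB : Functional C C.BgB} {δ θ : ℝ}
    (hbase : M.InBase EB W) (hbud : BaseBudget M W ctr BOp BHist) (hA : HistBudgetA M ctr EA W BHistA)
    (hop : M.OperatorRate W δ θ) (hδ : 0 ≤ δ) (hθ : 0 ≤ θ) (hθ1 : θ ≤ 1) (hOp : ∀ k, BOp k + δ * M.rOp k ≤ ROp k)
    (hHist : ∀ k, BHist k ≤ RHist k) (hHistA : ∀ k, BHistA k ≤ RHist k) :
    HistPairInClass M (ballClass ctr ROp RHist) EA EB W := by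
  intro k g hg U
  obtain ⟨hb1, hb2⟩ := hbud k g hg U (M.dataB EB g U k) (hbase k g hg U)
  have hθk : θ ^ k ≤ 1 := pow_le_one₀ hθ hθ1
  have hr : δ * θ ^ k * M.rOp k ≤ δ * 1 * M.rOp k :=
    mul_le_mul_of_nonneg_right (mul_le_mul_of_nonneg_left hθk hδ) (M.rOp_pos k).le
  have hopA : ‖M.opA g U k - (ctr k g U).1‖ ≤ ROp k :=
    calc ‖M.opA g U k - (ctr k g U).1‖ ≤ ‖M.opA g U k - M.opB g U k‖ + ‖M.opB g U k - (ctr k g U).1‖ :=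
          norm_sub_le_norm_sub_add_norm_sub _ _ _
      _ ≤ δ * θ ^ k * M.rOp k + BOp k := add_le_add (hop k g hg U) hb1
      _ ≤ ROp k := by linarith [hOp k]
  refine ⟨Set.mem_prod.2 ⟨?_, ?_⟩, Set.mem_prod.2 ⟨?_, ?_⟩⟩
  · rw [mem_closedBall, dist_eq_norm]; exact hopA
  · rw [mem_closedBall, dist_eq_norm]; exact hb2.trans (hHist k)
  · rw [mem_closedBall, dist_eq_norm]; exact hopA
  · rw [mem_closedBall, dist_eq_norm]; exact (hA k g hg U).trans (hHistA k)

variable (M)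

/-- **THE STEP WITH A REACH-FREE HISTORY LEG.**  The hypotheses of `T4InputCauchyRateSpecies.recursiveRate_of_stepModel_lip₂`
with the two-species datum `DataLipschitz₂ κ Λop Λhist ρ₀` replaced by an OPERATOR leg within reach `ρ₀` at base points
(`OpLipschitz κ Λop ρ₀`, W2-op, constant-only) and a CLASS-WIDE history secant (`HistSecant K κ Λhist`) between the leg's two
endpoints, which lie in the class (`HistPairInClass`) ⟹ `RecursiveRate EA EB W κ θ ω (Λop·δ + Λhist·δ′ + B) (Λhist·c)` —
the SAME budget as the species form.  What is GONE: the history half of the near hypothesis (`hnear` of lip₂: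
`(δ + δ′)θ^{k₀} + c(EA₀ + E₀)ω/(1 − ω) ≤ ρ₀`, i.e. the a-priori history reach and with it `ω < 1`, the capped levels, and —
downstream — every slack / room / dilation condition in the history species); what REMAINS of reach is the operator species
alone, `δθ^{k₀} ≤ ρ₀`.  Proof: first scales as in lip₂; at `k ≥ k₀` the triangle through the corner `(opA, histB)`: operator
leg at run B's (base) history within reach, history leg between the two class points at run A's operators. [folklore] -/
theorem recursiveRate_of_stepModel_secant {EA : Functional C C.BgA} {EB : Functional C C.BgB} {W : Set (ℕ → ℝ)}
    {κ Λop Λhist EA₀ E₀ δ δ' θ c ω ρ₀ B : ℝ} {k₀ : ℕ} (hrA : M.RepresentsA EA W) (hrB : M.RepresentsB EB W)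
    (hbase : M.InBase EB W) (hpair : HistPairInClass M K EA EB W) (hopL : OpLipschitz M W κ Λop ρ₀)
    (hsec : HistSecant M K W κ Λhist) (hdA : DecayBound EA W EA₀ κ) (hdB : DecayBound EB W E₀ κ)
    (hop : M.OperatorRate W δ θ) (hins : M.InsertionRate W κ E₀ δ' θ) (hdamp : M.InsertionDamped W κ c ω)
    (hΛop : 0 ≤ Λop) (hΛhist : 0 ≤ Λhist) (hδ : 0 ≤ δ) (hδ' : 0 ≤ δ') (hθ : 0 ≤ θ) (hθ1 : θ ≤ 1) (hc : 0 ≤ c)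
    (hω : 0 ≤ ω) (hreach : δ * θ ^ k₀ ≤ ρ₀) (hB : 0 ≤ B) (hfirst : ∀ k < k₀, EA₀ + E₀ ≤ B * θ ^ k) :
    RecursiveRate EA EB W κ θ ω (Λop * δ + Λhist * δ' + B) (Λhist * c) := by
  intro k D hD g hg U X hX
  set x₀ := M.opB g U k with hx₀
  set x₁ := M.opA g U k with hx₁
  set y₀ := M.insB g U k (tableB EB g U) with hy₀
  set y₁ := M.insA g U k (tableA EA g U) with hy₁
  have hrOp := M.rOp_pos k
  have hrHist := M.rHist_pos k
  have hexp := Real.exp_pos (-(κ * C.d X))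
  have hθk : 0 ≤ θ ^ k := pow_nonneg hθ k
  -- the inherited levels (NO capping: the history leg has no reach condition)
  set S := ∑ j ∈ range k, ω ^ (k - j) * D j with hS
  have hS0 : 0 ≤ S := sum_nonneg fun j hj => mul_nonneg (pow_nonneg hω _) (hD j (mem_range.1 hj)).1
  have htab : ∀ Y, C.scale Y < k →
      |tableA EA g U Y - tableB EB g U Y| ≤ D (C.scale Y) * Real.exp (-(κ * C.d Y)) :=
    fun Y hY => (hD (C.scale Y) hY).2 g hg U Y rfl
  -- operator discrepancy in margin units (MI-1); history discrepancy from the levels (MI-3a) + insertion rate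
  have hxd : ‖x₁ - x₀‖ ≤ δ * θ ^ k * M.rOp k := hop k g hg U
  have hdamp' : ‖y₁ - M.insA g U k (tableB EB g U)‖ ≤ M.rHist k * (c * S) :=
    hdamp k g hg U (tableA EA g U) (tableB EB g U) D (fun j hj => (hD j hj).1) htab
  have hins' := hins k g hg U (tableB EB g U) (fun Y => hdB g hg U Y)
  have hyd : ‖y₁ - y₀‖ ≤ (c * S + δ' * θ ^ k) * M.rHist k :=
    calc ‖y₁ - y₀‖ ≤ ‖y₁ - M.insA g U k (tableB EB g U)‖ + ‖M.insA g U k (tableB EB g U) - y₀‖ :=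
          norm_sub_le_norm_sub_add_norm_sub _ _ _
      _ ≤ M.rHist k * (c * S) + δ' * θ ^ k * M.rHist k := add_le_add hdamp' hins'
      _ = (c * S + δ' * θ ^ k) * M.rHist k := by ring
  -- the relative displacement per species
  set a := ‖x₁ - x₀‖ / M.rOp k with ha_def
  set b := ‖y₁ - y₀‖ / M.rHist k with hb_def
  have ha0 : 0 ≤ a := by positivity
  have hb0 : 0 ≤ b := by positivity
  have haδ : a ≤ δ * θ ^ k := by rw [ha_def, div_le_iff₀ hrOp]; exact hxd
  have hbS : b ≤ c * S + δ' * θ ^ k := by rw [hb_def, div_le_iff₀ hrHist]; exact hyd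
  -- the two runs' outputs are the real parts of the step output at the two data points
  have hdisc : disc EA EB g U X ≤ ‖M.Out k x₁ y₁ X - M.Out k x₀ y₀ X‖ := by
    have eA := hrA g hg U X
    have eB := hrB g hg U X
    rw [hX] at eA eB
    unfold disc
    rw [eA, eB, ← Complex.sub_re]
    exact Complex.abs_re_le_norm _
  have hsum : ∑ j ∈ range k, Λhist * c * ω ^ (k - j) * D j = Λhist * c * S := by
    rw [hS, mul_sum]
    exact sum_congr rfl fun j _ => by ring
  by_cases hk : k < k₀
  · -- FIRST SCALES: the one-run bounds, absorbed by the constant B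
    calc disc EA EB g U X ≤ |EA g (C.transport U) X| + |EB g U X| := abs_sub _ _
      _ ≤ EA₀ * Real.exp (-(κ * C.d X)) + E₀ * Real.exp (-(κ * C.d X)) :=
          add_le_add (hdA g hg _ X) (hdB g hg U X)
      _ = (EA₀ + E₀) * Real.exp (-(κ * C.d X)) := by ring
      _ ≤ B * θ ^ k * Real.exp (-(κ * C.d X)) := mul_le_mul_of_nonneg_right (hfirst k hk) hexp.le
      _ ≤ ((Λop * δ + Λhist * δ' + B) * θ ^ k + ∑ j ∈ range k, Λhist * c * ω ^ (k - j) * D j) *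
            Real.exp (-(κ * C.d X)) := by
          rw [hsum]
          apply mul_le_mul_of_nonneg_right _ hexp.le
          have h1 : 0 ≤ Λop * δ * θ ^ k := mul_nonneg (mul_nonneg hΛop hδ) hθk
          have h2 : 0 ≤ Λhist * δ' * θ ^ k := mul_nonneg (mul_nonneg hΛhist hδ') hθk
          have h3 : 0 ≤ Λhist * c * S := mul_nonneg (mul_nonneg hΛhist hc) hS0
          linarith
  · -- SCALES k ≥ k₀: operator leg within reach (operators ONLY), history leg class-wide through the corner (x₁, y₀)
    push Not at hk
    have hθkk₀ : θ ^ k ≤ θ ^ k₀ := pow_le_pow_of_le_one hθ hθ1 hk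
    have hq1 : ‖x₁ - x₀‖ ≤ ρ₀ * M.rOp k := by
      have : a ≤ ρ₀ := haδ.trans ((mul_le_mul_of_nonneg_left hθkk₀ hδ).trans hreach)
      rwa [ha_def, div_le_iff₀ hrOp] at this
    have hopleg : ‖M.Out k x₁ y₀ X - M.Out k x₀ y₀ X‖ ≤ Λop * a * Real.exp (-(κ * C.d X)) :=
      hopL k g hg U (M.dataB EB g U k) (hbase k g hg U) X hX x₁ hq1
    have hhleg : ‖M.Out k x₁ y₁ X - M.Out k x₁ y₀ X‖ ≤ Λhist * b * Real.exp (-(κ * C.d X)) :=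
      hsec k g hg U x₁ y₀ y₁ (hpair k g hg U).1 (hpair k g hg U).2 X hX
    have h2 : ‖M.Out k x₁ y₁ X - M.Out k x₀ y₀ X‖ ≤ (Λop * a + Λhist * b) * Real.exp (-(κ * C.d X)) :=
      calc ‖M.Out k x₁ y₁ X - M.Out k x₀ y₀ X‖
          ≤ ‖M.Out k x₁ y₁ X - M.Out k x₁ y₀ X‖ + ‖M.Out k x₁ y₀ X - M.Out k x₀ y₀ X‖ :=
            norm_sub_le_norm_sub_add_norm_sub _ _ _
        _ ≤ Λhist * b * Real.exp (-(κ * C.d X)) + Λop * a * Real.exp (-(κ * C.d X)) := add_le_add hhleg hopleg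
        _ = (Λop * a + Λhist * b) * Real.exp (-(κ * C.d X)) := by ring
    calc disc EA EB g U X ≤ _ := hdisc
      _ ≤ (Λop * a + Λhist * b) * Real.exp (-(κ * C.d X)) := h2
      _ ≤ (Λop * (δ * θ ^ k) + Λhist * (c * S + δ' * θ ^ k)) * Real.exp (-(κ * C.d X)) :=
          mul_le_mul_of_nonneg_right
            (add_le_add (mul_le_mul_of_nonneg_left haδ hΛop) (mul_le_mul_of_nonneg_left hbS hΛhist)) hexp.le
      _ ≤ ((Λop * δ + Λhist * δ' + B) * θ ^ k + ∑ j ∈ range k, Λhist * c * ω ^ (k - j) * D j) *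
            Real.exp (-(κ * C.d X)) := by
          rw [hsum]
          apply mul_le_mul_of_nonneg_right _ hexp.le
          have h1 : 0 ≤ B * θ ^ k := mul_nonneg hB hθk
          linarith

/-! ### Closures: smallness `ω + Λhist·c < θ′`, NO reach, slack, room or dilation in the history species -/

/-- **NE5 AT ANY SLOWER RATE FROM THE SECANT FACE, printed age normalisation.**  Natural history gain `c` at damping
`ω > 0` (`InsertionDampedNat`), inputs at rate `θ`, output NE5 at every `θ′ ∈ [θ, 1]` under the load-bearing smallness
`ω + Λhist·c < θ′` with constant `(Λop·δ + Λhist·δ′ + B)(θ′ − ω)/(θ′ − (ω + Λhist·c))` — the formulas of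
`T4InputCauchyRateSpecies.ne5_at_of_stepModel_lip₂_nat` VERBATIM, with `Λhist` now the class-wide secant modulus and the
near hypothesis shrunk to the operator reach `δθ^{k₀} ≤ ρ₀`. [folklore] -/
theorem ne5_at_of_stepModel_secant_nat {EA : Functional C C.BgA} {EB : Functional C C.BgB} {W : Set (ℕ → ℝ)}
    {κ Λop Λhist EA₀ E₀ δ δ' θ θ' c ω ρ₀ B : ℝ} {k₀ : ℕ} (hrA : M.RepresentsA EA W) (hrB : M.RepresentsB EB W)
    (hbase : M.InBase EB W) (hpair : HistPairInClass M K EA EB W) (hopL : OpLipschitz M W κ Λop ρ₀)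
    (hsec : HistSecant M K W κ Λhist) (hdA : DecayBound EA W EA₀ κ) (hdB : DecayBound EB W E₀ κ)
    (hop : M.OperatorRate W δ θ) (hins : M.InsertionRate W κ E₀ δ' θ) (hdamp : M.InsertionDampedNat W κ c ω)
    (hΛop : 0 ≤ Λop) (hΛhist : 0 ≤ Λhist) (hδ : 0 ≤ δ) (hδ' : 0 ≤ δ') (hθ : 0 ≤ θ) (hθθ' : θ ≤ θ') (hθ'1 : θ' ≤ 1)
    (hc : 0 ≤ c) (hω : 0 < ω) (hreach : δ * θ ^ k₀ ≤ ρ₀) (hB : 0 ≤ B) (hfirst : ∀ k < k₀, EA₀ + E₀ ≤ B * θ ^ k)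
    (hsmall : ω + Λhist * c < θ') :
    NE5 EA EB W κ θ' ((Λop * δ + Λhist * δ' + B) * (θ' - ω) / (θ' - (ω + Λhist * c))) := by
  have h1 : (1 + Λhist * (c / ω)) * ω = ω + Λhist * c := by
    rw [add_mul, one_mul, mul_assoc Λhist, div_mul_cancel₀ c hω.ne']
  have hrec := recursiveRate_of_stepModel_secant M hrA hrB hbase hpair hopL hsec hdA hdB hop hins
    (M.insertionDamped_of_nat hdamp hω) hΛop hΛhist hδ hδ' hθ (hθθ'.trans hθ'1) (div_nonneg hc hω.le) hω.le hreach hB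
    hfirst
  have key := ne5_at_of_recursiveRate (add_nonneg (add_nonneg (mul_nonneg hΛop hδ) (mul_nonneg hΛhist hδ')) hB)
    (mul_nonneg hΛhist (div_nonneg hc hω.le)) hω.le hθ hθθ' (by rw [h1]; exact hsmall) hrec
  rwa [h1] at key

/-- **EXISTENCE OF A RATE NEEDS ONLY ROOM IN THE PRODUCT `Λhist·c`**: at an input rate `θ < 1`, the single condition
`ω + Λhist·c < 1` yields SOME rate `θ′ < 1` with a constant (witness `θ′ = max(θ, (ω + Λhist·c + 1)/2)`). [folklore] -/
theorem exists_rate_of_stepModel_secant_nat {EA : Functional C C.BgA} {EB : Functional C C.BgB} {W : Set (ℕ → ℝ)}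
    {κ Λop Λhist EA₀ E₀ δ δ' θ c ω ρ₀ B : ℝ} {k₀ : ℕ} (hrA : M.RepresentsA EA W) (hrB : M.RepresentsB EB W)
    (hbase : M.InBase EB W) (hpair : HistPairInClass M K EA EB W) (hopL : OpLipschitz M W κ Λop ρ₀)
    (hsec : HistSecant M K W κ Λhist) (hdA : DecayBound EA W EA₀ κ) (hdB : DecayBound EB W E₀ κ)
    (hop : M.OperatorRate W δ θ) (hins : M.InsertionRate W κ E₀ δ' θ) (hdamp : M.InsertionDampedNat W κ c ω)
    (hΛop : 0 ≤ Λop) (hΛhist : 0 ≤ Λhist) (hδ : 0 ≤ δ) (hδ' : 0 ≤ δ') (hθ : 0 ≤ θ) (hθ1 : θ < 1) (hc : 0 ≤ c)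
    (hω : 0 < ω) (hreach : δ * θ ^ k₀ ≤ ρ₀) (hB : 0 ≤ B) (hfirst : ∀ k < k₀, EA₀ + E₀ ≤ B * θ ^ k)
    (hroom : ω + Λhist * c < 1) : ∃ θ', θ' < 1 ∧ ∃ C₅, NE5 EA EB W κ θ' C₅ :=
  ⟨max θ ((ω + Λhist * c + 1) / 2), max_lt hθ1 (by linarith), _,
    ne5_at_of_stepModel_secant_nat M hrA hrB hbase hpair hopL hsec hdA hdB hop hins hdamp hΛop hΛhist hδ hδ' hθ
      (le_max_left _ _) (max_le hθ1.le (by linarith)) hc hω hreach hB hfirst (lt_max_of_lt_right (by linarith))⟩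

/-- **NE5 FROM THE SECANT FACE WITH THE INSERTION WALL IN ITS PRIMITIVE TYPED FORM** (`InsAffine ∧ InsBlind ∧ InsHomog ∧
InsScaleBound κ E₁ c ω`, W3, exactly as in `T4InputCauchyRateSpecies.ne5_at_of_stepModel_fibre₂_scale_nat`). [folklore] -/
theorem ne5_at_of_stepModel_secant_scale_nat {EA : Functional C C.BgA} {EB : Functional C C.BgB} {W : Set (ℕ → ℝ)}
    {κ Λop Λhist EA₀ E₀ E₁ δ δ' θ θ' c ω ρ₀ B : ℝ} {k₀ : ℕ} (hrA : M.RepresentsA EA W) (hrB : M.RepresentsB EB W)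
    (hbase : M.InBase EB W) (hpair : HistPairInClass M K EA EB W) (hopL : OpLipschitz M W κ Λop ρ₀)
    (hsec : HistSecant M K W κ Λhist) (hdA : DecayBound EA W EA₀ κ) (hdB : DecayBound EB W E₀ κ)
    (hop : M.OperatorRate W δ θ) (hins : M.InsertionRate W κ E₀ δ' θ) (haff : M.InsAffine W) (hblind : M.InsBlind W)
    (hhom : M.InsHomog W) (hunit : M.InsScaleBound W κ E₁ c ω) (hE₁ : 0 < E₁) (hΛop : 0 ≤ Λop) (hΛhist : 0 ≤ Λhist)
    (hδ : 0 ≤ δ) (hδ' : 0 ≤ δ') (hθ : 0 ≤ θ) (hθθ' : θ ≤ θ') (hθ'1 : θ' ≤ 1) (hc : 0 ≤ c) (hω : 0 < ω)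
    (hreach : δ * θ ^ k₀ ≤ ρ₀) (hB : 0 ≤ B) (hfirst : ∀ k < k₀, EA₀ + E₀ ≤ B * θ ^ k) (hsmall : ω + Λhist * c < θ') :
    NE5 EA EB W κ θ' ((Λop * δ + Λhist * δ' + B) * (θ' - ω) / (θ' - (ω + Λhist * c))) :=
  ne5_at_of_stepModel_secant_nat M hrA hrB hbase hpair hopL hsec hdA hdB hop hins
    (M.insertionDampedNat_of_affine haff (M.sizeDampedNat_of_scaleBound haff hblind hhom hunit hE₁)) hΛop hΛhist hδ hδ'
    hθ hθθ' hθ'1 hc hω hreach hB hfirst hsmall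

variable (T : ℕ → ι → Op → Hist → C.Dom → ℂ)

/-- **NE5 FROM TERMWISE HISTORY MODULI** — the socket form: `TermRep ∧ TermHistLip κ ℓ ∧ TermBudget ℓ Λhist` (any producer of
the termwise moduli) in place of `HistSecant`; smallness `ω + Λhist·c < θ′` with `Λhist` the FIRST-MOMENT budget of the
moduli. [folklore] -/
theorem ne5_at_of_stepModel_termLip_scale_nat {EA : Functional C C.BgA} {EB : Functional C C.BgB} {W : Set (ℕ → ℝ)}
    {ℓ : ℕ → ι → ℝ} {κ Λop Λhist EA₀ E₀ E₁ δ δ' θ θ' c ω ρ₀ B : ℝ} {k₀ : ℕ} (hrA : M.RepresentsA EA W)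
    (hrB : M.RepresentsB EB W) (hbase : M.InBase EB W) (hpair : HistPairInClass M K EA EB W)
    (hopL : OpLipschitz M W κ Λop ρ₀) (hrep : TermRep M K T W) (hlip : TermHistLip M K T W κ ℓ)
    (hbud : TermBudget ℓ Λhist) (hdA : DecayBound EA W EA₀ κ) (hdB : DecayBound EB W E₀ κ) (hop : M.OperatorRate W δ θ)
    (hins : M.InsertionRate W κ E₀ δ' θ) (haff : M.InsAffine W) (hblind : M.InsBlind W) (hhom : M.InsHomog W)
    (hunit : M.InsScaleBound W κ E₁ c ω) (hE₁ : 0 < E₁) (hΛop : 0 ≤ Λop) (hΛhist : 0 ≤ Λhist) (hδ : 0 ≤ δ)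
    (hδ' : 0 ≤ δ') (hθ : 0 ≤ θ) (hθθ' : θ ≤ θ') (hθ'1 : θ' ≤ 1) (hc : 0 ≤ c) (hω : 0 < ω) (hreach : δ * θ ^ k₀ ≤ ρ₀)
    (hB : 0 ≤ B) (hfirst : ∀ k < k₀, EA₀ + E₀ ≤ B * θ ^ k) (hsmall : ω + Λhist * c < θ') :
    NE5 EA EB W κ θ' ((Λop * δ + Λhist * δ' + B) * (θ' - ω) / (θ' - (ω + Λhist * c))) :=
  ne5_at_of_stepModel_secant_scale_nat M hrA hrB hbase hpair hopL (histSecant_of_termHistLip hrep hlip hbud) hdA hdB hop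
    hins haff hblind hhom hunit hE₁ hΛop hΛhist hδ hδ' hθ hθθ' hθ'1 hc hω hreach hB hfirst hsmall

open _root_.MeasureTheory in
/-- **NE5 FROM EXP-LINEAR TERMWISE DATA BY THE SECANT FACE**: `TermRep`, the exp-linear structure with named exponent bounds
`N` (margin units) and ABSOLUTE majorants `a`, first-moment budget `Σᵢ Nᵢaᵢ ≤ G₁`; history modulus `Λhist = 2G₁`; smallness
`ω + 2G₁·c < θ′`; constant `(Λop·δ + 2G₁·δ′ + B)(θ′ − ω)/(θ′ − (ω + 2G₁·c))`.  No analyticity hypothesis, no reach, slack or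
room in the history species; the operator leg `OpLipschitz` (W2-op) is consumed as typed. [folklore] -/
theorem ne5_at_of_stepModel_expLinear_secant_scale_nat {EA : Functional C C.BgA} {EB : Functional C C.BgB}
    {W : Set (ℕ → ℝ)} {α : ℕ → ι → Type*} [∀ k i, MeasurableSpace (α k i)] {μ : ∀ k i, Op → C.Dom → Measure (α k i)}
    {Φ : ∀ k i, Op → C.Dom → α k i → ℂ} {Λ : ∀ k i, Op → C.Dom → α k i → (Hist →L[ℂ] ℂ)} {a N : ℕ → ι → ℝ}
    {κ Λop G₁ EA₀ E₀ E₁ δ δ' θ θ' c ω ρ₀ B : ℝ} {k₀ : ℕ} (hrA : M.RepresentsA EA W) (hrB : M.RepresentsB EB W)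
    (hbase : M.InBase EB W) (hpair : HistPairInClass M K EA EB W) (hopL : OpLipschitz M W κ Λop ρ₀)
    (hrep : TermRep M K T W) (hexp : TermHistExpLinearN M K T W μ Φ Λ N) (habs : ExpLinearAbsBound K W κ a μ Φ Λ)
    (hN0 : ∀ k i, 0 ≤ N k i) (hmom : ∀ k, Summable (fun i => N k i * a k i) ∧ ∑' i, N k i * a k i ≤ G₁) (hG₁ : 0 ≤ G₁)
    (hdA : DecayBound EA W EA₀ κ) (hdB : DecayBound EB W E₀ κ) (hop : M.OperatorRate W δ θ)
    (hins : M.InsertionRate W κ E₀ δ' θ) (haff : M.InsAffine W) (hblind : M.InsBlind W) (hhom : M.InsHomog W)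
    (hunit : M.InsScaleBound W κ E₁ c ω) (hE₁ : 0 < E₁) (hΛop : 0 ≤ Λop) (hδ : 0 ≤ δ) (hδ' : 0 ≤ δ') (hθ : 0 ≤ θ)
    (hθθ' : θ ≤ θ') (hθ'1 : θ' ≤ 1) (hc : 0 ≤ c) (hω : 0 < ω) (hreach : δ * θ ^ k₀ ≤ ρ₀) (hB : 0 ≤ B)
    (hfirst : ∀ k < k₀, EA₀ + E₀ ≤ B * θ ^ k) (hsmall : ω + 2 * G₁ * c < θ') :
    NE5 EA EB W κ θ' ((Λop * δ + 2 * G₁ * δ' + B) * (θ' - ω) / (θ' - (ω + 2 * G₁ * c))) :=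
  ne5_at_of_stepModel_secant_scale_nat M hrA hrB hbase hpair hopL (histSecant_of_expLinear hrep hexp habs hN0 hmom) hdA
    hdB hop hins haff hblind hhom hunit hE₁ hΛop (by positivity) hδ hδ' hθ hθθ' hθ'1 hc hω hreach hB hfirst hsmall

open _root_.MeasureTheory in
/-- **NE5 FROM EXP-LINEAR TERMWISE DATA ON THE BUDGET BALL CLASS** — the secant route end to end: class = the ball class of
radii `ROp ≥ BOp + δ·rOp`, `RHist ≥ max(BHist, BHistA)` (the two runs' history BUDGETS; no margin added — contrast the room
inequality `BHist + rHist ≤ RHist` of every Cauchy-faced closure), leg endpoints placed in it by `histPairInClass_ballClass`;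
then `ne5_at_of_stepModel_expLinear_secant_scale_nat`. [folklore] -/
theorem ne5_at_of_stepModel_expLinear_secant_budget_scale_nat {EA : Functional C C.BgA} {EB : Functional C C.BgB}
    {W : Set (ℕ → ℝ)} {ctr : ℕ → (ℕ → ℝ) → C.BgB → Op × Hist} {BOp BHist BHistA ROp RHist : ℕ → ℝ}
    {α : ℕ → ι → Type*} [∀ k i, MeasurableSpace (α k i)] {μ : ∀ k i, Op → C.Dom → Measure (α k i)}
    {Φ : ∀ k i, Op → C.Dom → α k i → ℂ} {Λ : ∀ k i, Op → C.Dom → α k i → (Hist →L[ℂ] ℂ)} {a N : ℕ → ι → ℝ}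
    {κ Λop G₁ EA₀ E₀ E₁ δ δ' θ θ' c ω ρ₀ B : ℝ} {k₀ : ℕ} (hrA : M.RepresentsA EA W) (hrB : M.RepresentsB EB W)
    (hbase : M.InBase EB W) (hbud : BaseBudget M W ctr BOp BHist) (hA : HistBudgetA M ctr EA W BHistA)
    (hOp : ∀ k, BOp k + δ * M.rOp k ≤ ROp k) (hHist : ∀ k, BHist k ≤ RHist k) (hHistA : ∀ k, BHistA k ≤ RHist k)
    (hopL : OpLipschitz M W κ Λop ρ₀) (hrep : TermRep M (ballClass ctr ROp RHist) T W)
    (hexp : TermHistExpLinearN M (ballClass ctr ROp RHist) T W μ Φ Λ N)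
    (habs : ExpLinearAbsBound (ballClass ctr ROp RHist) W κ a μ Φ Λ) (hN0 : ∀ k i, 0 ≤ N k i)
    (hmom : ∀ k, Summable (fun i => N k i * a k i) ∧ ∑' i, N k i * a k i ≤ G₁) (hG₁ : 0 ≤ G₁)
    (hdA : DecayBound EA W EA₀ κ) (hdB : DecayBound EB W E₀ κ) (hop : M.OperatorRate W δ θ)
    (hins : M.InsertionRate W κ E₀ δ' θ) (haff : M.InsAffine W) (hblind : M.InsBlind W) (hhom : M.InsHomog W)
    (hunit : M.InsScaleBound W κ E₁ c ω) (hE₁ : 0 < E₁) (hΛop : 0 ≤ Λop) (hδ : 0 ≤ δ) (hδ' : 0 ≤ δ') (hθ : 0 ≤ θ)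
    (hθθ' : θ ≤ θ') (hθ'1 : θ' ≤ 1) (hc : 0 ≤ c) (hω : 0 < ω) (hreach : δ * θ ^ k₀ ≤ ρ₀) (hB : 0 ≤ B)
    (hfirst : ∀ k < k₀, EA₀ + E₀ ≤ B * θ ^ k) (hsmall : ω + 2 * G₁ * c < θ') :
    NE5 EA EB W κ θ' ((Λop * δ + 2 * G₁ * δ' + B) * (θ' - ω) / (θ' - (ω + 2 * G₁ * c))) :=
  ne5_at_of_stepModel_expLinear_secant_scale_nat M T hrA hrB hbase
    (histPairInClass_ballClass hbase hbud hA hop hδ hθ (hθθ'.trans hθ'1) hOp hHist hHistA) hopL hrep hexp habs hN0 hmom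
    hG₁ hdA hdB hop hins haff hblind hhom hunit hE₁ hΛop hδ hδ' hθ hθθ' hθ'1 hc hω hreach hB hfirst hsmall

end Recursion

/-! ## §5 The deciding toy: a history-BLIND bulk — every Cauchy-faced closure is void, the secant closure fires -/

section ToySecant

open _root_.MeasureTheory

/-- `eˣ ≤ 8` for `x ≤ 2` (`e² < 7.39`). [folklore] -/
theorem exp_le_eight_of_le_two {x : ℝ} (hx : x ≤ 2) : Real.exp x ≤ 8 := by
  have h := Real.exp_one_lt_d9
  have h2 : Real.exp 2 = Real.exp 1 * Real.exp 1 := by rw [← Real.exp_add]; norm_num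
  calc Real.exp x ≤ Real.exp 2 := Real.exp_le_exp.2 hx
    _ ≤ 8 := by rw [h2]; nlinarith [Real.exp_pos 1]

/-- Run B of the secant toy: `E_B(0) = 100`, `E_B(k + 1) = 100 + (exp(E_B(k)/64) − 1)/8` — a history-BLIND bulk `100` plus
a small history-sensitive part. [folklore] -/
def toyRateS : ℕ → ℝ
  | 0 => 100
  | n + 1 => 100 + (Real.exp (1 / 64 * toyRateS n) - 1) / 8

/-- Run A of the secant toy: the same recursion plus the operator artifact `(1/2)^k`. [folklore] -/
def toyRateSA : ℕ → ℝ
  | 0 => 1 + 100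
  | n + 1 => (1 / 2 : ℝ) ^ (n + 1) + 100 + (Real.exp (1 / 64 * toyRateSA n) - 1) / 8

/-- Run B's recursion in closed form. [folklore] -/
theorem toyRateS_step (n : ℕ) :
    toyRateS n = 100 + (Real.exp (if n = 0 then 0 else 1 / 64 * toyRateS (n - 1)) - 1) / 8 := by
  cases n with
  | zero => simp [toyRateS]
  | succ m => simp [toyRateS]

/-- Run A's recursion in closed form. [folklore] -/
theorem toyRateSA_step (n : ℕ) :
    toyRateSA n = (1 / 2 : ℝ) ^ n + 100 + (Real.exp (if n = 0 then 0 else 1 / 64 * toyRateSA (n - 1)) - 1) / 8 := by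
  cases n with
  | zero => simp [toyRateSA]
  | succ m => simp [toyRateSA]

/-- The history-sensitive part is at most `1` at levels `≤ 102` (`e^{102/64} ≤ e² ≤ 8`). [folklore] -/
theorem toy_histPart_mem {x : ℝ} (h0 : 0 ≤ x) (hx : x ≤ 102) :
    0 ≤ (Real.exp (1 / 64 * x) - 1) / 8 ∧ (Real.exp (1 / 64 * x) - 1) / 8 ≤ 1 := by
  have h1 : 1 ≤ Real.exp (1 / 64 * x) := Real.one_le_exp (by positivity)
  have h2 : Real.exp (1 / 64 * x) ≤ 8 := exp_le_eight_of_le_two (by linarith)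
  constructor
  · linarith
  · linarith

/-- Run B's outputs lie in `[100, 102]`. [folklore] -/
theorem toyRateS_mem (n : ℕ) : 100 ≤ toyRateS n ∧ toyRateS n ≤ 102 := by
  induction n with
  | zero => simp only [toyRateS]; norm_num
  | succ m ih =>
    simp only [toyRateS]
    have := toy_histPart_mem (x := toyRateS m) (by linarith [ih.1]) ih.2
    constructor <;> linarith [this.1, this.2]

/-- Run A's outputs lie in `[100, 102]`. [folklore] -/
theorem toyRateSA_mem (n : ℕ) : 100 ≤ toyRateSA n ∧ toyRateSA n ≤ 102 := by
  induction n with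
  | zero => simp only [toyRateSA]; norm_num
  | succ m ih =>
    simp only [toyRateSA]
    have := toy_histPart_mem (x := toyRateSA m) (by linarith [ih.1]) ih.2
    have hp : 0 ≤ (1 / 2 : ℝ) ^ (m + 1) := by positivity
    have hp1 : (1 / 2 : ℝ) ^ (m + 1) ≤ 1 := pow_le_one₀ (by norm_num) (by norm_num)
    constructor <;> linarith [this.1, this.2]

/-- Toy run A as a functional on v1's toy carriers. [folklore] -/
def toyEAS : Functional toyCarriers toyCarriers.BgA := fun _ _ X => toyRateSA (toyCarriers.scale X)

/-- Toy run B as a functional on v1's toy carriers. [folklore] -/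
def toyEBS : Functional toyCarriers toyCarriers.BgB := fun _ _ X => toyRateS (toyCarriers.scale X)

/-- The secant toy model: file v5's `toyModel` (operator data `(1/2)^k` versus `0`, the same insertion "read the previous
scale with gain 1/64" for both runs, unit margins) with the output map `Out(o, h) = o + 100 + (exp(h) − 1)/8` — a
history-blind bulk `100`, a history-sensitive exponential of weight `1/8` — and base class `{o = 0, ‖h‖ ≤ 2}`. [folklore] -/
def toyModelS : StepModel toyCarriers ℂ ℂ :=
  { toyModel with
    Out := fun _ o h _ => o + 100 + (Complex.exp h - 1) / 8
    Base := fun _ _ _ => {p | p.1 = 0 ∧ ‖p.2‖ ≤ 2} }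

/-- Real part of the toy output at real history data. [folklore] -/
theorem toyS_out_re (o : ℂ) (x : ℝ) :
    (o + 100 + (Complex.exp (x : ℂ) - 1) / 8).re = o.re + 100 + (Real.exp x - 1) / 8 := by
  have h : (Complex.exp (x : ℂ) - 1) / 8 = (((Real.exp x - 1) / 8 : ℝ) : ℂ) := by push_cast; ring
  rw [h, Complex.add_re, Complex.add_re, Complex.ofReal_re]
  norm_num

/-- The toy insertion of a table, as a real cast. [folklore] -/
theorem toyIns_eq (k : ℕ) (t : toyCarriers.Dom → ℝ) :
    toyIns k t = ((if k = 0 then 0 else 1 / 64 * t (k - 1) : ℝ) : ℂ) := by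
  unfold toyIns
  split_ifs <;> simp

/-- Toy: run B is represented — the defining recursion of `toyRateS`. [folklore] -/
theorem toyS_representsB : toyModelS.RepresentsB toyEBS Set.univ := by
  intro g _ U X
  show toyRateS (toyCarriers.scale X) =
    ((0 : ℂ) + 100 + (Complex.exp (toyIns (toyCarriers.scale X) (tableB toyEBS g U)) - 1) / 8).re
  rw [toyIns_eq, toyS_out_re, Complex.zero_re, zero_add, toyRateS_step (toyCarriers.scale X)]
  rfl

/-- Toy: run A is represented — the defining recursion of `toyRateSA`. [folklore] -/
theorem toyS_representsA : toyModelS.RepresentsA toyEAS Set.univ := by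
  intro g _ U X
  show toyRateSA (toyCarriers.scale X) =
    ((((1 / 2 : ℝ) ^ toyCarriers.scale X : ℝ) : ℂ) + 100 +
      (Complex.exp (toyIns (toyCarriers.scale X) (tableA toyEAS g U)) - 1) / 8).re
  rw [toyIns_eq, toyS_out_re, Complex.ofReal_re, toyRateSA_step (toyCarriers.scale X)]
  rfl

/-- Norm of the inserted history of a table of level `≤ 102`: at most `102/64 ≤ 2`. [folklore] -/
theorem norm_toyIns_le {k : ℕ} {t : toyCarriers.Dom → ℝ} (ht : ∀ Y, |t Y| ≤ 102) : ‖toyIns k t‖ ≤ 2 := by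
  rw [toyIns_eq, Complex.norm_real, Real.norm_eq_abs]
  split_ifs
  · simp
  · rw [abs_mul, abs_of_pos (by norm_num : (0 : ℝ) < 1 / 64)]
    linarith [ht (k - 1)]

/-- Toy: run B's data `(0, E_B(k−1)/64)` lie in the base class `{o = 0, ‖h‖ ≤ 2}`. [folklore] -/
theorem toyS_inBase : toyModelS.InBase toyEBS Set.univ := by
  intro k g _ U
  refine ⟨rfl, ?_⟩
  show ‖toyIns k (tableB toyEBS g U)‖ ≤ 2
  exact norm_toyIns_le fun Y => by
    show |toyRateS (toyCarriers.scale Y)| ≤ 102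
    rw [abs_of_nonneg (by linarith [(toyRateS_mem (toyCarriers.scale Y)).1])]
    exact (toyRateS_mem _).2

/-- Toy: one-run bound of run A with constant `102`. [folklore] -/
theorem toyS_decayA : DecayBound toyEAS Set.univ 102 0 := by
  intro g _ U X
  simp only [toyEAS, zero_mul, neg_zero, Real.exp_zero, mul_one]
  rw [abs_of_nonneg (by linarith [(toyRateSA_mem (toyCarriers.scale X)).1])]
  exact (toyRateSA_mem _).2

/-- Toy: one-run bound of run B with constant `102`. [folklore] -/
theorem toyS_decayB : DecayBound toyEBS Set.univ 102 0 := by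
  intro g _ U X
  simp only [toyEBS, zero_mul, neg_zero, Real.exp_zero, mul_one]
  rw [abs_of_nonneg (by linarith [(toyRateS_mem (toyCarriers.scale X)).1])]
  exact (toyRateS_mem _).2

/-- Toy: run B's budgets around the centre `(0, 0)`: operators `0`, histories `2`. [folklore] -/
theorem toyS_baseBudget : BaseBudget toyModelS Set.univ toyCtr (fun _ => 0) fun _ => 2 := by
  intro k g _ U p hp
  obtain ⟨h1, h2⟩ := hp
  refine ⟨?_, ?_⟩
  · simp [toyCtr, h1]
  · simpa [toyCtr] using h2

/-- Toy: run A's history budget around the centre: `2` (its tables have level `≤ 102`). [folklore] -/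
theorem toyS_histBudgetA : HistBudgetA toyModelS toyCtr toyEAS Set.univ fun _ => 2 := by
  intro k g _ U
  show ‖toyIns k (tableA toyEAS g U) - 0‖ ≤ 2
  rw [sub_zero]
  exact norm_toyIns_le fun Y => by
    show |toyRateSA (toyCarriers.scale Y)| ≤ 102
    rw [abs_of_nonneg (by linarith [(toyRateSA_mem (toyCarriers.scale Y)).1])]
    exact (toyRateSA_mem _).2

/-- Toy: operator discrepancy `(1/2)^k` margins (file v5's `toy_operatorRate`, same operator data). [folklore] -/
theorem toyS_operatorRate : toyModelS.OperatorRate Set.univ 1 (1 / 2) := toy_operatorRate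

/-- Toy: the two runs insert identically (`δ′ = 0`), at table level `102`. [folklore] -/
theorem toyS_insertionRate : toyModelS.InsertionRate Set.univ 0 102 0 (1 / 2) := by
  intro k g _ U t _
  show ‖toyIns k t - toyIns k t‖ ≤ 0 * (1 / 2) ^ k * 1
  simp

/-- Toy: the structural insertion shapes (file v5's, same insertion maps). [folklore] -/
theorem toyS_insAffine : toyModelS.InsAffine Set.univ := toy_insAffine

/-- Toy: blindness to scales `≥ k`. [folklore] -/
theorem toyS_insBlind : toyModelS.InsBlind Set.univ := toy_insBlind

/-- Toy: real homogeneity. [folklore] -/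
theorem toyS_insHomog : toyModelS.InsHomog Set.univ := toy_insHomog

/-- Toy: the single-scale size bound, gain `1/64`, any `ω ≥ 0`. [folklore] -/
theorem toyS_insScaleBound {ω : ℝ} (hω : 0 ≤ ω) : toyModelS.InsScaleBound Set.univ 0 3 (1 / 64) ω :=
  toy_insScaleBound hω

/-- Toy: the operator leg is EXACT — `Out(o, h) − Out(o′, h) = o − o′`: `OpLipschitz` with modulus `1`, ANY reach.
[folklore] -/
theorem toyS_opLipschitz (ρ₀ : ℝ) : OpLipschitz toyModelS Set.univ 0 1 ρ₀ := by
  intro k g _ U p _ X _ o _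
  show ‖(o + 100 + (Complex.exp p.2 - 1) / 8) - (p.1 + 100 + (Complex.exp p.2 - 1) / 8)‖ ≤
    1 * (‖o - p.1‖ / 1) * Real.exp (-(0 * toyCarriers.d X))
  rw [zero_mul, neg_zero, Real.exp_zero, mul_one, one_mul, div_one]
  apply le_of_eq
  congr 1
  ring

/-- The secant toy's class: the ball class of radii `(1, 2)` around the origin — EXACTLY the budgets, no room. [folklore] -/
abbrev toyClassS : ℕ → (ℕ → ℝ) → toyCarriers.BgB → Set (ℂ × ℂ) := ballClass toyCtr (fun _ => 1) fun _ => 2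

/-- The toy's THREE-TERM FAMILY: `T₀ = o + 100` (history-blind bulk), `T₁ = exp(h)/8`, `T₂ = −1/8`. [folklore] -/
def toyTermS : ℕ → Fin 3 → ℂ → ℂ → toyCarriers.Dom → ℂ := fun _ i o h _ => ![o + 100, Complex.exp h / 8, -1 / 8] i

/-- The toy's exponent bounds in margin units: `(0, 1, 0)` — only `T₁` sees the history. [folklore] -/
def toyNS : ℕ → Fin 3 → ℝ := fun _ i => ![0, 1, 0] i

/-- The toy's ABSOLUTE majorants on the class: `(101, 1, 1)` (`‖o + 100‖ ≤ 101`, `e^{Re h}/8 ≤ e²/8 ≤ 1`, `1/8 ≤ 1`).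
[folklore] -/
def toyAbsS : ℕ → Fin 3 → ℝ := fun _ i => ![101, 1, 1] i

/-- The toy's measure spaces: a Dirac mass on the one-point space, for every term. [folklore] -/
abbrev toyMeasS : ℕ → Fin 3 → ℂ → toyCarriers.Dom → Measure Unit := fun _ _ _ _ => Measure.dirac ()

/-- The toy's history-independent weights: `(o + 100, 1/8, −1/8)`. [folklore] -/
def toyPhiS : ℕ → Fin 3 → ℂ → toyCarriers.Dom → Unit → ℂ := fun _ i o _ _ => ![o + 100, 1 / 8, -1 / 8] i

/-- The toy's exponents: `(0, id, 0)`. [folklore] -/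
def toyLamS : ℕ → Fin 3 → ℂ → toyCarriers.Dom → Unit → (ℂ →L[ℂ] ℂ) :=
  fun _ i _ _ _ => ![0, ContinuousLinearMap.id ℂ ℂ, 0] i

/-- Toy: `TermRep` — `(o + 100) + exp(h)/8 + (−1/8) = o + 100 + (exp h − 1)/8`, a finite sum. [folklore] -/
theorem toyS_termRep : TermRep toyModelS toyClassS toyTermS Set.univ := by
  intro k g _ U q _ X _
  have h := hasSum_fintype fun i : Fin 3 => toyTermS k i q.1 q.2 X
  have h2 : ∑ i : Fin 3, toyTermS k i q.1 q.2 X = q.1 + 100 + (Complex.exp q.2 - 1) / 8 := by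
    rw [Fin.sum_univ_three]
    show q.1 + 100 + Complex.exp q.2 / 8 + -1 / 8 = q.1 + 100 + (Complex.exp q.2 - 1) / 8
    ring
  rw [h2] at h
  exact h

/-- On the class: `‖q.1‖ ≤ 1`, `‖q.2‖ ≤ 2`. [folklore] -/
theorem toyClassS_norm {k : ℕ} {g : ℕ → ℝ} {U : toyCarriers.BgB} {q : ℂ × ℂ} (hq : q ∈ toyClassS k g U) :
    ‖q.1‖ ≤ 1 ∧ ‖q.2‖ ≤ 2 := by
  obtain ⟨hq1, hq2⟩ := Set.mem_prod.1 hq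
  rw [mem_closedBall, dist_eq_norm] at hq1 hq2
  exact ⟨by simpa [toyCtr] using hq1, by simpa [toyCtr] using hq2⟩

/-- `‖exp h‖/8 ≤ 1` for `‖h‖ ≤ 2`. [folklore] -/
theorem norm_cexp_div_eight_le {h : ℂ} (hh : ‖h‖ ≤ 2) : ‖Complex.exp h‖ / 8 ≤ 1 := by
  rw [Complex.norm_exp, div_le_one (by norm_num : (0 : ℝ) < 8)]
  exact exp_le_eight_of_le_two ((Complex.re_le_norm h).trans hh)

/-- Toy: `TermHistExpLinearN` — `o + 100 = ∫ (o + 100)·exp(0 h) dδ`, `exp(h)/8 = ∫ (1/8)·exp(id h) dδ`,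
`−1/8 = ∫ (−1/8)·exp(0 h) dδ`; exponent bounds `(0, 1, 0)` margins (`rHist = 1`). [folklore] -/
theorem toyS_termHistExpLinearN : TermHistExpLinearN toyModelS toyClassS toyTermS Set.univ (α := fun _ _ => Unit)
    toyMeasS toyPhiS toyLamS toyNS := by
  intro k g _ U q _ X _ i
  fin_cases i
  · refine ⟨integrable_const _, fun y => aestronglyMeasurable_const, ae_of_all _ fun _ => ?_, ?_⟩
    · show ‖(0 : ℂ →L[ℂ] ℂ)‖ * 1 ≤ 0
      rw [norm_zero, zero_mul]
    · show q.1 + 100 = ∫ _a : Unit, (q.1 + 100) * Complex.exp ((0 : ℂ →L[ℂ] ℂ) q.2) ∂(Measure.dirac ())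
      rw [integral_dirac]
      simp
  · refine ⟨integrable_const _, fun y => aestronglyMeasurable_const, ae_of_all _ fun _ => ?_, ?_⟩
    · show ‖ContinuousLinearMap.id ℂ ℂ‖ * 1 ≤ 1
      rw [mul_one]; exact ContinuousLinearMap.norm_id_le
    · show Complex.exp q.2 / 8 = ∫ _a : Unit, 1 / 8 * Complex.exp (ContinuousLinearMap.id ℂ ℂ q.2) ∂(Measure.dirac ())
      rw [integral_dirac, ContinuousLinearMap.id_apply]
      ring
  · refine ⟨integrable_const _, fun y => aestronglyMeasurable_const, ae_of_all _ fun _ => ?_, ?_⟩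
    · show ‖(0 : ℂ →L[ℂ] ℂ)‖ * 1 ≤ 0
      rw [norm_zero, zero_mul]
    · show (-1 / 8 : ℂ) = ∫ _a : Unit, (-1 / 8 : ℂ) * Complex.exp ((0 : ℂ →L[ℂ] ℂ) q.2) ∂(Measure.dirac ())
      rw [integral_dirac]
      simp

/-- Toy: `ExpLinearAbsBound` with the absolute majorants `(101, 1, 1)` on the class. [folklore] -/
theorem toyS_expLinearAbsBound : ExpLinearAbsBound toyClassS Set.univ 0 toyAbsS (α := fun _ _ => Unit)
    toyMeasS toyPhiS toyLamS := by
  intro k g _ U q hq X _ i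
  obtain ⟨h1, h2⟩ := toyClassS_norm hq
  rw [zero_mul, neg_zero, Real.exp_zero, mul_one]
  fin_cases i
  · show ∫ _a : Unit, ‖q.1 + 100‖ * ‖Complex.exp ((0 : ℂ →L[ℂ] ℂ) q.2)‖ ∂(Measure.dirac ()) ≤ 101
    rw [integral_dirac, zero_apply, Complex.exp_zero, norm_one, mul_one]
    calc ‖q.1 + 100‖ ≤ ‖q.1‖ + ‖(100 : ℂ)‖ := norm_add_le _ _
      _ ≤ 1 + 100 := add_le_add h1 (by simp)
      _ = 101 := by norm_num
  · show ∫ _a : Unit, ‖(1 / 8 : ℂ)‖ * ‖Complex.exp (ContinuousLinearMap.id ℂ ℂ q.2)‖ ∂(Measure.dirac ()) ≤ 1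
    rw [integral_dirac, ContinuousLinearMap.id_apply]
    have h8 : ‖(1 / 8 : ℂ)‖ = 1 / 8 := by simp
    rw [h8]
    have := norm_cexp_div_eight_le h2
    linarith
  · show ∫ _a : Unit, ‖(-1 / 8 : ℂ)‖ * ‖Complex.exp ((0 : ℂ →L[ℂ] ℂ) q.2)‖ ∂(Measure.dirac ()) ≤ 1
    rw [integral_dirac, zero_apply, Complex.exp_zero, norm_one, mul_one]
    have h8 : ‖(-1 / 8 : ℂ)‖ = 1 / 8 := by simp
    rw [h8]; norm_num

/-- Toy: the first-moment budget `Σᵢ Nᵢaᵢ = 0·101 + 1·1 + 0·1 = 1` — the history-blind bulk does NOT enter. [folklore] -/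
theorem toyS_moment (k : ℕ) : Summable (fun i => toyNS k i * toyAbsS k i) ∧ ∑' i, toyNS k i * toyAbsS k i ≤ 1 := by
  refine ⟨(hasSum_fintype _).summable, ?_⟩
  rw [tsum_fintype, Fin.sum_univ_three]
  show (0 : ℝ) * 101 + 1 * 1 + 0 * 1 ≤ 1
  norm_num

/-- **THE SECANT CLOSURE FIRES ON THE TOY** (vacuity witness for `ne5_at_of_stepModel_expLinear_secant_budget_scale_nat`):
budgets `(0, 2)` and run A's history budget `2` into the ball class of radii `(1, 2)` — the budgets themselves, NO room;
three exp-linear terms with exponent bounds `(0, 1, 0)` and absolute majorants `(101, 1, 1)`, first moment `G₁ = 1`, history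
modulus `Λhist = 2`; exact operator leg `Λop = 1` with reach `ρ₀ = 1` from `k₀ = 0` (`B = 0`); rates `δ = 1`, `δ′ = 0`,
`θ = θ′ = 1/2`; gain `c = 1/64` at `ω = 1/64`; smallness `1/64 + 2·1·(1/64) = 3/64 < 1/2`; constant `31/29`. [folklore] -/
theorem toyS_ne5_secant : NE5 toyEAS toyEBS (Set.univ : Set (ℕ → ℝ)) 0 (1 / 2)
    ((1 * 1 + 2 * 1 * 0 + 0) * (1 / 2 - 1 / 64) / (1 / 2 - (1 / 64 + 2 * 1 * (1 / 64)))) :=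
  ne5_at_of_stepModel_expLinear_secant_budget_scale_nat toyModelS toyTermS (ctr := toyCtr) (BOp := fun _ => 0)
    (BHist := fun _ => 2) (BHistA := fun _ => 2) (ROp := fun _ => 1) (RHist := fun _ => 2) (a := toyAbsS) (N := toyNS)
    (ρ₀ := 1) (B := 0) (k₀ := 0) (E₁ := 3)
    toyS_representsA toyS_representsB toyS_inBase toyS_baseBudget toyS_histBudgetA
    (fun k => by show (0 : ℝ) + 1 * 1 ≤ 1; norm_num) (fun k => le_rfl) (fun k => le_rfl) (toyS_opLipschitz 1)
    toyS_termRep toyS_termHistExpLinearN toyS_expLinearAbsBound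
    (fun k i => by fin_cases i <;> simp [toyNS]) toyS_moment zero_le_one toyS_decayA toyS_decayB
    toyS_operatorRate toyS_insertionRate toyS_insAffine toyS_insBlind toyS_insHomog (toyS_insScaleBound (by norm_num))
    (by norm_num) zero_le_one zero_le_one le_rfl (by norm_num) le_rfl (by norm_num) (by norm_num) (by norm_num)
    (by norm_num) le_rfl (fun k hk => absurd hk (Nat.not_lt_zero k)) (by norm_num)

/-- [analysis] The secant instance's numbers: smallness `3/64 < 1/2`, constant `31/29`. [folklore] -/
example : (1 : ℝ) / 64 + 2 * 1 * (1 / 64) = 3 / 64 ∧ (3 : ℝ) / 64 < 1 / 2 ∧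
    ((1 : ℝ) * 1 + 2 * 1 * 0 + 0) * (1 / 2 - 1 / 64) / (1 / 2 - (1 / 64 + 2 * 1 * (1 / 64))) = 31 / 29 := by norm_num

/-! ### The other direction of the decision: on this toy every Cauchy-faced closure of the lineage is VOID -/

/-- **NO SLACK IN THE SECANT CLASS**: the two-margin box around run B's step-1 base point `(0, 100/64)` leaves the ball
class of radii `(1, 2)` (the point `(0, 100/64 + 1)` has a history of norm `> 2`) — `BoxInClass`, the entrance ticket of
every Cauchy-faced class closure (`T4InputCauchyRateSpecies` §6, `T4InputCauchyRateTermwise` §2/§4/§7), FAILS on the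
class on which the secant closure has just fired. [folklore] -/
theorem toyS_not_boxInClass : ¬ BoxInClass toyModelS toyClassS Set.univ := by
  intro h
  have hp : ((0 : ℂ), (((100 : ℝ) / 64 : ℝ) : ℂ)) ∈ toyModelS.Base 1 (fun _ => 1) () := by
    refine ⟨rfl, ?_⟩
    show ‖(((100 : ℝ) / 64 : ℝ) : ℂ)‖ ≤ 2
    rw [Complex.norm_real, Real.norm_eq_abs, abs_of_pos (by norm_num)]
    norm_num
  have hz : ((0 : ℂ), (((100 : ℝ) / 64 + 1 : ℝ) : ℂ)) ∈ toyModelS.box 1 ((0 : ℂ), (((100 : ℝ) / 64 : ℝ) : ℂ)) := by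
    refine Set.mem_prod.2 ⟨?_, ?_⟩
    · show (0 : ℂ) ∈ closedBall (0 : ℂ) 1
      exact mem_closedBall_self zero_le_one
    · show (((100 : ℝ) / 64 + 1 : ℝ) : ℂ) ∈ closedBall ((((100 : ℝ) / 64 : ℝ) : ℂ)) 1
      rw [mem_closedBall, dist_eq_norm, ← Complex.ofReal_sub, Complex.norm_real, Real.norm_eq_abs]
      norm_num
  have hK := h 1 (fun _ => 1) (Set.mem_univ _) () _ hp hz
  have h2 := (toyClassS_norm hK).2
  simp only at h2
  rw [Complex.norm_real, Real.norm_eq_abs, abs_of_pos (by norm_num)] at h2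
  norm_num at h2

/-- **ANY CLASS WITH SLACK HAS CLASS CONSTANT `≥ 100`**: if the boxes around base points lie in a class `K` on which the
output is bounded by `G` (`ClassBound K 0 G`), then `100 ≤ G` — run B's step-1 data point is a base point, hence a class
point, and its output has real part `100 + (e^{100/64} − 1)/8 ≥ 100`.  The history-BLIND bulk is in every sup-norm class
constant. [folklore] -/
theorem toyS_classBound_ge {K : ℕ → (ℕ → ℝ) → toyCarriers.BgB → Set (ℂ × ℂ)} {G : ℝ}
    (hbox : BoxInClass toyModelS K Set.univ) (hG : ClassBound toyModelS K Set.univ 0 G) : 100 ≤ G := by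
  have hmem : toyModelS.dataB toyEBS (fun _ => 1) () 1 ∈ K 1 (fun _ => 1) () :=
    hbox 1 (fun _ => 1) (Set.mem_univ _) () _ (toyS_inBase 1 (fun _ => 1) (Set.mem_univ _) ())
      (Set.mem_prod.2 ⟨mem_closedBall_self (toyModelS.rOp_pos 1).le, mem_closedBall_self (toyModelS.rHist_pos 1).le⟩)
  have hb := hG 1 (fun _ => 1) (Set.mem_univ _) () _ hmem (1 : ℕ) rfl
  rw [zero_mul, neg_zero, Real.exp_zero, mul_one] at hb
  have hre : (toyModelS.Out 1 (toyModelS.dataB toyEBS (fun _ => 1) () 1).1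
      (toyModelS.dataB toyEBS (fun _ => 1) () 1).2 (1 : ℕ)).re = 0 + 100 + (Real.exp (1 / 64 * toyRateS 0) - 1) / 8 := by
    show ((0 : ℂ) + 100 + (Complex.exp (toyIns 1 (tableB toyEBS (fun _ => 1) ())) - 1) / 8).re = _
    rw [toyIns_eq, toyS_out_re, Complex.zero_re]
    simp [tableB, toyEBS, toyCarriers]
  have h100 : (100 : ℝ) ≤ 0 + 100 + (Real.exp (1 / 64 * toyRateS 0) - 1) / 8 := by
    have := (toy_histPart_mem (x := toyRateS 0) (by simp [toyRateS]) (by simp [toyRateS]; norm_num)).1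
    linarith
  calc (100 : ℝ) ≤ _ := h100
    _ = _ := hre.symm
    _ ≤ ‖toyModelS.Out 1 (toyModelS.dataB toyEBS (fun _ => 1) () 1).1
          (toyModelS.dataB toyEBS (fun _ => 1) () 1).2 (1 : ℕ)‖ := Complex.re_le_norm _
    _ ≤ G := hb

/-- **… SO HAS EVERY TERMWISE MAJORANT BUDGET ON A CLASS WITH SLACK**: for ANY term family `T` representing the toy's
output on a class `K` containing the boxes, with termwise majorants `m` of budget `G` (`TermRep ∧ TermBound K 0 m ∧
TermBudget m G`, the data of every termwise Cauchy-faced closure of `T4InputCauchyRateTermwise` §2/§4/§7), `100 ≤ G` — by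
`T4InputCauchyRateTermwise.classBound_of_termwise` and `toyS_classBound_ge`: the sum of the majorants majorises the bulk.
[folklore] -/
theorem toyS_termBudget_ge {ι : Type*} {K : ℕ → (ℕ → ℝ) → toyCarriers.BgB → Set (ℂ × ℂ)}
    {T : ℕ → ι → ℂ → ℂ → toyCarriers.Dom → ℂ} {m : ℕ → ι → ℝ} {G : ℝ} (hbox : BoxInClass toyModelS K Set.univ)
    (hrep : TermRep toyModelS K T Set.univ) (hbd : TermBound K T Set.univ 0 m) (hbud : TermBudget m G) : 100 ≤ G :=
  toyS_classBound_ge hbox (classBound_of_termwise hrep hbd hbud)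

/-- **… AND EVERY HISTORY FIBRE ENVELOPE**: a history fibre envelope of the toy (`HistFibreEnvelopeCl 0 G`, the weakest
Cauchy-faced species datum of the lineage, `T4InputCauchyRateTermwise` §4; v5's `HistFibreEnvelope` implies it) has
`100 ≤ G` — the envelope at run B's step-1 base point, centre of its own fibre (`ζ = 0`), bounds the output's norm, whose
real part is `100 + (e^{100/64} − 1)/8`. [folklore] -/
theorem toyS_histFibreEnvelopeCl_ge {G : ℝ} (h : HistFibreEnvelopeCl toyModelS Set.univ 0 G) : 100 ≤ G := by
  set p := toyModelS.dataB toyEBS (fun _ => 1) () 1 with hp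
  have hb := (h 1 (fun _ => 1) (Set.mem_univ _) () p (toyS_inBase 1 (fun _ => 1) (Set.mem_univ _) ()) (1 : ℕ) rfl p.1
    (mem_closedBall_self (toyModelS.rOp_pos 1).le) 0 (by rw [norm_zero]; exact (toyModelS.rHist_pos 1).le)).2 0
    (mem_closedBall_self zero_le_one)
  simp only [zero_smul, add_zero, zero_mul, neg_zero, Real.exp_zero, mul_one] at hb
  have hre : (toyModelS.Out 1 p.1 p.2 (1 : ℕ)).re = 0 + 100 + (Real.exp (1 / 64 * toyRateS 0) - 1) / 8 := by
    show ((0 : ℂ) + 100 + (Complex.exp (toyIns 1 (tableB toyEBS (fun _ => 1) ())) - 1) / 8).re = _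
    rw [toyIns_eq, toyS_out_re, Complex.zero_re]
    simp [tableB, toyEBS, toyCarriers]
  have h100 : (100 : ℝ) ≤ 0 + 100 + (Real.exp (1 / 64 * toyRateS 0) - 1) / 8 := by
    have := (toy_histPart_mem (x := toyRateS 0) (by simp [toyRateS]) (by simp [toyRateS]; norm_num)).1
    linarith
  calc (100 : ℝ) ≤ _ := h100
    _ = _ := hre.symm
    _ ≤ ‖toyModelS.Out 1 p.1 p.2 (1 : ℕ)‖ := Complex.re_le_norm _
    _ ≤ G := hb

/-- v5's (stronger) history fibre envelope of the toy has `100 ≤ G` as well. [folklore] -/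
theorem toyS_histFibreEnvelope_ge {G : ℝ} (h : toyModelS.HistFibreEnvelope Set.univ 0 G) : 100 ≤ G :=
  toyS_histFibreEnvelopeCl_ge (histFibreEnvelopeCl_of_histFibreEnvelope h)

/-- **HENCE EVERY CAUCHY-FACED SMALLNESS IS VOID ON THE TOY**: with a class constant `G ≥ 100`, the toy's natural gain
`c = 1/64` and ANY reach `ρ₀ ∈ [0, 1)`, the load-bearing smallness `ω + G·c/(1 − ρ₀) < θ′` of the class closures of
`T4InputCauchyRateSpecies` §6–§8 / `T4InputCauchyRateTermwise` cannot hold at any rate `θ′ ≤ 1` and any damping `ω ≥ 0`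
(`G·c/(1 − ρ₀) ≥ 100/64 > 1`).  With `toyS_ne5_secant`: the toy DECIDES between the faces. [folklore] -/
theorem toyS_cauchy_smallness_void {G ω ρ₀ θ' : ℝ} (hG : 100 ≤ G) (hω : 0 ≤ ω) (hρ₀ : 0 ≤ ρ₀) (hρ₁ : ρ₀ < 1)
    (hθ' : θ' ≤ 1) : ¬ (ω + G / (1 - ρ₀) * (1 / 64) < θ') := by
  intro h
  have h1 : 0 < 1 - ρ₀ := by linarith
  have hG' : G ≤ G / (1 - ρ₀) := by
    rw [le_div_iff₀ h1]
    nlinarith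
  nlinarith

/-- [analysis] NUMBERS (h) row: at `γ₀ = 1`, `ω = 1/16`, `N̄ν = 1/100` the secant smallness `1/16 + 2/100 = 33/400` lies
below the (g″) dilation row `λ = 2`, `μ = 1`, `ν = 1/100` (`479/5744`) — same digits, none of its side conditions. [folklore] -/
example : (1 : ℝ) / 16 + 2 * 1 * (1 / 100) = 33 / 400 ∧ (33 : ℝ) / 400 < 479 / 5744 := by norm_num

end ToySecant

end Literature.MathematicalPhysics.QuantumFieldTheory.Balaban1983to89.T4InputCauchyRateSecant
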